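import Literature.MathematicalPhysics.QuantumFieldTheory.Balaban1983to89.T4TrajectoryModulus
import Literature.MathematicalPhysics.QuantumFieldTheory.Balaban1983to89.B16
import Literature.Analysis.Complex.HolomorphicParametricIntegral

/-!
# T4TrajectoryDensity — THE PRINTED RATIO MECHANISM (1.73)–(1.75) OF [Balaban1989LargeFieldII] AT MEASURE LEVEL: an
HONEST normalised complex-weight fluctuation operation SUPPLIES §L's class-guarded operator slice `OpSliceOn` of
`T4TrajectoryModulus` with the PRINTED constant `a = e^{3 sup|σ|}` and GENUINE background dependence (cell `pub-balaban`,
T4-DAG row T4-O3.E-NE1′-PROVE-P1k*, node O3b / H2, prover seat P1, technique «RG-trajectory comparison»; kernel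
[folklore] measure theory / one-variable complex analysis / real arithmetic + ONE typed seam; NOT summit progress)
v1.2 (gen 19, self-row `T4-O3.E-NE1′-PROVE-P1m*` under T4-DAG §8 Q24(a), record v1.19; ADDITIVE — §1–§8 and their text
byte-identical to v1.1, no page of [Balaban1989LargeFieldII] newly read, no sentence newly attributed to print; an
OWN-INSPECTION FINDING on v1.1's seam and its typed repair): §9 DEGENERACY — v1.1's `RealBase` asks the exponent to be
REAL a.e. at EVERY point of the window, `ExponentSlice` asks it HOLOMORPHIC along every admissible slice, and the
`ℤ^d` pipeline's nesting (N2) one level up makes every window but the last COMPLEX-OPEN in all chart directions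
(`smulDir`: admissible directions are closed under complex scaling); holomorphic + real-valued on an open disc ⇒
constant (open mapping theorem, `eventually_const_of_im_eq_zero`) ⇒ constant on the tube about `[0,1]` (identity
theorem, `eqOn_const_of_im_eq_zero`), so `σ_t ≡ 0`: the binders `hB k`, `hE k`, `hN2 (k+1)`, `hw`, `hϱ` of
`transportsFromVar_of_exponentSlices_lattice` force the step-`k` exponent — hence the weights and the operation — to
be locally BACKGROUND-INDEPENDENT at every met step `k ≤ K − 2` (`exponent_const_on_tube`,
`exponent_const_on_tube_lattice`, `exponent_locallyConst_lattice`, `wOp_expWeight_locallyConst_lattice`,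
`exponent_locallyConst_of_capstone_binders`); nothing landed is false — the v1.1 seam is MIS-CUT relative to p. 379,
where reality holds at the real regular configuration (U,0) UNDER the complex point (𝐔,𝐉), not at (𝐔,𝐉) (§8's witness
met `RealBase` only because `realBall` has empty interior in `ℂ`).  §10 THE RE-CUT: `RealBaseAt ref` /
`ExponentSliceAt ref` state reality, integrability and the oscillation bound at a REFERENCE configuration `ref U₀`
(`ref = id` ⇔ v1.1: `realBaseAt_id_iff`, `exponentSliceAt_id_iff`); the constructor `weightSlice_of_exponentSliceAt`
(`ρ₀ = base·e^{−Re 𝒜_{ref U₀}}`, `σ_t = 𝒜_{ref U₀} − 𝒜_{move U₀ d t}`), the supplier `opSliceOn_wOp_expAt` and the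
`ℤ^d` pipeline `transportsFromVar_of_exponentSlicesAt_lattice` (SAME conclusion, compositions BY NAME).  §11
NON-VACUITY ON A COMPLEX-OPEN WINDOW: on `([0,1], Lebesgue)`, `𝒰 = ℂ`, window `closedBall 0 1`, `ref U = Re U`
(`reRef`), `𝒜 = linExp (s/5)`: `realBaseAt_linExp_closedBall`, `exponentSliceAt_linExp_closedBall`,
`weightSlice_linExp_closedBall` (every `s ≥ 0`, genuine background dependence, `linExp_slice_not_const`), while v1.1's
`RealBase` is REFUTED on the same window for every `c ≠ 0` (`not_realBase_linExp_closedBall`).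
v1.2.1 (gen 19, DOCFIX ride-along owed since v1: XREAD C-ref6-163 INFO I-1): the windowed docstring of §4's
`transportsFromVar_of_weightSlices_windowed` now repeats §2's off-good-set caveat at the `hFn` gloss; no declaration,
statement or proof touched.
v1.1 (gen 16, row `T4-O3.E-NE1′-PROVE-P1l*`, record v1.18; ADDITIVE — §1–§6 and their text byte-identical to v1, no
page of [Balaban1989LargeFieldII] newly read, no sentence newly attributed to print): §7 reads §3's ONE typed seam
`WeightSlice` off EXPONENT DATA — weights `ω_U = base · e^{−𝒜_U}` (`expWeight`), a real regular base (`RealBase`: `base ≥ 0`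
a.e., the window's constraint set `support base` of positive measure, the exponent measurable and REAL a.e. at every
regular base, `base · e^{−Re 𝒜_{U₀}}` integrable) and an exponent slice (`ExponentSlice`: along every birth-chart slice the
exponent is measurable, HOLOMORPHIC in the chart parameter, and of OSCILLATION `≤ s` about its base value) ⇒ `WeightSlice`
with `ρ₀ = base · e^{−Re 𝒜_{U₀}}`, `σ_t = 𝒜_{U₀} − 𝒜_{move U₀ d t}` (`weightSlice_of_exponentSlice`); the positivity of the
base mass becomes STRUCTURAL (`integral_baseDensity_pos`: `e^{−𝒜(U,0)} > 0` is automatic, only `μ (support base) > 0` is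
asked, uniformly in the background); the supplier and the `ℤ^d` pipeline in this currency (`opSliceOn_wOp_exp`,
`transportsFromVar_of_exponentSlices_lattice`, compositions BY NAME); §8 non-vacuity over a REAL base set with genuine
background dependence (`realBase_linExp`, `exponentSlice_linExp`, `weightSlice_linExp`; `expWeight 1 (linExp c) = expLin c`).
v1 (gen 11, row `T4-O3.E-NE1′-PROVE-P1k*`, record `t4/T4-EST-NE1p-P1.md` v1.17).  WHY A NEW LEAF: the lineage's fifth
leaf `T4TrajectoryModulus` (v1.4, p191219) has 194 936 of the gate's 200 000 bytes; this sixth leaf continues it by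
IMPORT — one writer, append-only by file, nothing of the five earlier leaves (`T4BirthChartTransport`, `T4RelativeLadder`,
`T4BlockTransport`, `T4TrajectoryComparison`, `T4TrajectoryModulus`) modified or restated.  It also imports, BY NAME and
WITH CREDIT, the cell's typing `B16` of [Balaban1989LargeFieldII] (seat b02: the pointwise kernel
`B16.exp_neg_two_norm_le_re_cexp` of (1.74) and the real arithmetic `B16.ineq175` of (1.75); b02's `B16.ineq173/174/175`
are the three displays over a FINITE positive functional) and the support file
`Literature.Analysis.Complex.HolomorphicParametricIntegral` (holomorphy of dominated parameter integrals, [folklore]).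
CONVENTION: `§n` below = section n of THIS file; `§F`, `§H`, `§J`, `§K`, `§L` = the lettered sections of
`T4TrajectoryModulus`.

HONEST FRAMING (cell `pub-balaban`, T4-DAG PAGE 1).  Rung (B)+1 of the cell's ladder on a FINITE four-torus:
existence and uniqueness of the continuum limit of Bałaban's unit-scale averaged loop expectations — CONDITIONAL on
BetaPertH and on (B)/(B^μ) wherever a consumer row uses them (THIS MODULE USES NONE OF THEM: an abstract measure space,
abstract normed spaces, the landed abstract `T4TermFormat.Booking` arrays, real arithmetic); NOT infinite volume, NOT the
Yang–Mills mass gap, NOT the Clay problem.  ABSOLUTE RULE honoured: no internally-minted statement is cited as a fact —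
the one analytic input below is a HYPOTHESIS SHAPE (`WeightSlice`, a `def … : Prop`), every theorem is [folklore]
elementary measure theory / complex analysis / real arithmetic on abstract data, kernel-checked; [Balaban1989LargeFieldII]
is quoted for CONTEXT and for the SHAPE of its undisputed small-field bookkeeping (1.73)–(1.75) only, never for a
disputed step; programme-internal analyses are labelled [cell] and are NOT facts.

THE ROW (payload of this seat, verbatim): «DRESSED STABILITY in the observable-attached format — (ℝT)^K on ρ₀·f_μ with
the (2.18)-type representation extended by observable-attached terms, μ-uniform constants. … RG-trajectory comparison:
extend B12's (2.18) inductive representation term by term with the observable insertion, tracking μ-uniformity through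
the printed small-field bounds.»  THIS FILE tracks the one printed small-field bound the §J/§L dictionary names for the
per-step operator constant `a` — (1.75) p. 380 — from its printed mechanism to §L's binder `hop`, in kernel.

WHAT THIS FILE ADDS (kernel-checked; every item [folklore] unless marked):
§1 (1.73)–(1.75) AT MEASURE LEVEL.  For a measure space `(Z, μ)`, a density `ρ₀ ≥ 0` a.e., integrable, of total mass
   `P = ∫ ρ₀ dμ`, a complex exponent `σ : Z → ℂ` a.e.-strongly measurable with `‖σ‖ ≤ s` a.e., and the weight
   `weight ρ₀ σ = ρ₀ · e^{σ}`: (1.73) `norm_integral_weight_smul_le` — `‖∫ ρ₀e^{σ} • h dμ‖ ≤ P·e^{s}·m` for `‖h‖ ≤ m` a.e.;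
   (1.74) `mul_exp_le_re_integral_weight` — `P·e^{−2s} ≤ Re ∫ ρ₀e^{σ} dμ` for `s ≤ 1` (pointwise kernel = b02's
   `B16.exp_neg_two_norm_le_re_cexp`, imported; `Re` under the integral = Mathlib's `integral_re`), whence
   `integral_weight_ne_zero` for `P > 0`; (1.75) `norm_ratio_le` — `‖(∫ρ₀e^{σ})⁻¹ • ∫ρ₀e^{σ}•h‖ ≤ e^{3s}·m` (real
   arithmetic = b02's `B16.ineq175`, imported).  §1 is the measure-theoretic form of b02's finite-functional typing — the
   form an operation that is LITERALLY an integral over fluctuation variables (§F typing T1, §L) consumes.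
§2 THE OPERATION AND ITS CLASS.  `wOp ω μ z₀ U h := (∫ ω_U dμ)⁻¹ • ∫ ω_U • h dμ` when `ω_U` is integrable with non-zero
   integral, ELSE `h z₀` — a TOTALISATION: the printed operation exists on the analyticity window only, while §J–§L
   evaluate `E U` at every `U : 𝒰` and ask normalisation `hnorm` and class-subtractivity `hsub` at every `U`; evaluation at
   a fixed point `z₀` off the good set makes both hold identically (`wOp_const`, `wOp_sub`) and is never met on a window,
   where §3 shows the good branch is taken.  The class `BddClass F μ` (a.e.-strongly measurable, essentially bounded
   integrands) contains the constants (`const_mem_bddClass`) and is closed under differences (`sub_mem_bddClass`): §L's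
   `h𝒢c`, `h𝒢s`; weights times class members are integrable (`integrable_smul_of_mem_bddClass`).
§3 THE WEIGHT SLICE — printed TYPE, NOT asserted — AND THE SUPPLIER.  `WeightSlice ω μ move N 𝒦 w ϱ s`: for every regular
   base `U₀ ∈ 𝒦` and admissible direction (`0 < N d ≤ w`) an OPEN `Ω ⊇` the closed discs of radius `ϱ / N d` about
   `[0,1]` and a factorisation `ω_{move U₀ d t} = ρ₀ · e^{σ_t}` a.e. for `t ∈ Ω`, with `ρ₀ ≥ 0` integrable of positive
   mass and INDEPENDENT of `t` (print: "the operation for a regular G-valued configuration U"), `σ_t` a.e.-measurable,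
   `t ↦ σ_t(z)` holomorphic on `Ω` for a.e. `z`, `‖σ_t(z)‖ ≤ s` (print: "the additional small, and possible complex valued,
   term in the exponential").  THE SUPPLIER `opSliceOn_wOp`: `WeightSlice`, `s ≤ 1` and `D` of full measure ⇒
   `OpSliceOn (BddClass F μ) (wOp ω μ z₀) D move N 𝒦 w ϱ (exp (3 s))` — the sup half is (1.75); the analyticity half is
   holomorphy of the two dominated parameter integrals (`Literature.Analysis.Complex.differentiableOn_integral_of_dominated`,
   majorants `|ρ₀|e^{s}` and `|ρ₀|e^{s}m`) and of their quotient, the denominator non-vanishing on `Ω` by (1.74).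
§4 CONSUMPTION BY §L, BY NAME.  `contStepLawOn_wOp` = `T4TrajectoryModulus.contStepLawOn_of_linearOpSliceOn_windowed` with
   its five operation binders (`h𝒢c`, `h𝒢s`, `hsub`, `hnorm`, `hop`) DISCHARGED by §2–§3 (constants `e^{3s}`, `4e^{3s}/ϱ`);
   `transportsFromVar_of_weightSlices_windowed` / `transportsFromVar_of_weightSlices_lattice` =
   `T4TrajectoryModulus.transportsFromVar_of_linearOpSlicesOn_windowed` / `…_lattice` with, per met step `k`, the operation
   `wOp (ω k) (μ k) (z₀ k)`, the class `BddClass F (μ k)` and `a k = exp (3 s_k)`, `s_k ≤ 1`: SAME conclusion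
   `T.TransportsFromVar (4c_δ/r) (fun i => ψ·α i) Gate`, the domination reading `exp (3 s_k)·(1 + 4θ/ϱ) ≤ α k` — the
   per-step constant is the PRINTED (1.75) constant, uniform in everything except `sup|σ|`; in particular it does not see
   the observable or `μ` (the row's "μ-uniformity through the printed small-field bounds", for this one binder).
§5 NON-VACUITY with GENUINE background dependence (toy): on `([0,1], Lebesgue)`, `𝒰 = ℂ`, `move U _ t = U + t`, the
   weights `ω_U(z) = e^{(s/4)·U·z}` (`expLin`) satisfy `WeightSlice … (closedBall 0 1) 1 1 s` for every `s ≥ 0`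
   (`weightSlice_expLin`: `Ω = ball 0 3`, `ρ₀ = 1`, `σ_t(z) = (s/4)(U₀ + t)z`), hence at `s = 1` the supplier's conclusion
   with `a = e³`; unlike the toys of §J/§K/§L (no `U`-dependence at all) the operation here DEPENDS on the background
   through the weight — the vacuity concern INFO I-3 of XREAD C-pv22g20-2 ("any instantiation must exhibit a non-empty
   class with genuine `h𝒢c`/`h𝒢`") is met by `BddClass`.  Nothing of Bałaban's operations is modelled.
§6 SMALLNESS IS LOAD-BEARING IN (1.74): `ineq174_needs_smallness` — the conclusion of b02's `B16.ineq174` with the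
   hypothesis `s ≤ 1` deleted is FALSE at `s = π/2`: the two-point positive functional `w = (½, ½)` annihilates `e^{σ}`
   for `σ = (iπ/2, −iπ/2)` (`sum_exp_eq_zero_at_pi_half`).  Print states (1.74) with "σ is the small term of the first
   order in 𝐀′, 𝐉" (p. 380) and derives the g_k-smallness of σ on p. 379 (cell GAPS C-B16-5 for the quadratic-form half
   σ_Q; the V(X̃) half is the cell's OPEN objection G-adv3-21) — so §6 CERTIFIES THAT THE PRINTED SMALLNESS IS USED; it is
   not an objection.  (Numerics, not kernel: the pointwise kernel `Re e^{σ} ≥ e^{−2|σ|}` holds exactly for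
   `|σ| ≤ x⋆ ≈ 1.521`, the binding case being σ purely imaginary, `cos x⋆ = e^{−2x⋆}`; b02 certifies `|σ| ≤ 1`.)
§7 (v1.1) THE WEIGHT SLICE FROM EXPONENT DATA.  `expWeight base 𝒜 U z = base z · e^{−𝒜 U z}`; `baseDensity base 𝒜 U₀ =
   base · e^{−Re 𝒜_{U₀}}` (`≥ 0` a.e. from `base ≥ 0` a.e.; `support = support base`, so `0 < ∫ρ₀ ⇔ 0 < μ (support base)`
   given integrability — `integral_baseDensity_pos`); the pointwise factorisation `expWeight_eq_weight`: where `𝒜_{U₀}(z)`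
   is real, `ω_U(z) = ρ₀(z)·e^{𝒜_{U₀}(z) − 𝒜_U(z)}` — σ is LITERALLY the difference of the exponents; the hypothesis shapes
   `ExponentSlice 𝒜 μ move N 𝒦 w ϱ s` and `RealBase base 𝒜 μ 𝒦` (printed TYPE + the one interior-point clause; NOT
   asserted); THE CONSTRUCTOR `weightSlice_of_exponentSlice : RealBase → ExponentSlice → WeightSlice (expWeight base 𝒜) …`;
   `opSliceOn_wOp_exp` (§3 ∘ §7, constant `e^{3s}`, `s` = the oscillation of the exponent along the slice);
   `transportsFromVar_of_exponentSlices_lattice` = §4's `ℤ^d` pipeline with `hws` replaced by `hB`/`hE` per met step.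
§8 (v1.1) NON-VACUITY OF THE EXPONENT CURRENCY: on `([0,1], Lebesgue)`, `𝒰 = ℂ`, real base set
   `realBall = {U | Im U = 0, ‖U‖ ≤ 1}`, `base = 1`, `𝒜_U(z) = −c·U·z` (`linExp c`): `realBase_linExp` (every `c`),
   `exponentSlice_linExp` (`c = s/3`, `Ω = ball 0 3`, oscillation `(s/3)·|t|·|z| ≤ s`), hence `weightSlice_linExp` and, at
   `s = 1`, the supplier's conclusion with `a = e³` for `wOp (expWeight 1 (linExp ⅓)) … 0`.  Nothing of Bałaban's modelled.
§9 (v1.2) DEGENERACY OF THE v1.1 CURRENCY ON COMPLEX-OPEN WINDOWS [folklore one-variable complex analysis + measure theory]: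
   `eventually_const_of_im_eq_zero` (holomorphic and real-valued near `t₀` ⇒ eventually constant — open mapping theorem),
   `eqOn_const_of_im_eq_zero` (⇒ constant on an open preconnected `W ⊆ Ω` — identity theorem), `im_eq_zero_of_dense`, the tube
   `tube ρ = thickening ρ [0,1]` (open, convex, `⊆ Ω` of any slice, `⊇ [0,1]`); `exponent_const_on_tube`: reality a.e. at every
   window point + `ExponentSlice` + a slice staying in the window for `‖t‖ < δ` ⇒ for a.e. `z` the exponent is CONSTANT in `t` on
   the tube (reality at countably many slice points is transported to the disc by continuity); `wOp_congr_ae`; on `ℤ^d`: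
   `smulDir`/`zeroDir`/`fldDir` (admissible directions are closed under COMPLEX scaling), `exponent_const_on_tube_lattice` and
   `exponent_locallyConst_lattice` (`RealBase` + `ExponentSlice` on `𝒦₁` + (N2) from `𝒦₂` into `𝒦₁` ⇒ `𝒜 (V + z' + f) = 𝒜 (V + z')`
   a.e. for EVERY bond field `f` of sup-norm `≤ w`), `wOp_expWeight_locallyConst_lattice` (⇒ equal weights a.e. and equal
   operation on every integrand), `exponent_locallyConst_of_capstone_binders` (the same, on the binder family `hw`, `hϱ`, `hB`,
   `hE`, `hN2` of `transportsFromVar_of_exponentSlices_lattice` VERBATIM, at every `k ≤ K − 2`).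
§10 (v1.2) THE RE-CUT SEAM: `ExponentSliceAt ref` / `RealBaseAt ref` (printed TYPE at the REFERENCE `ref U₀`; NOT asserted;
   `ref = id` ⇔ §7), `weightSlice_of_exponentSliceAt`, `opSliceOn_wOp_expAt`, `transportsFromVar_of_exponentSlicesAt_lattice`.
§11 (v1.2) NON-VACUITY OF THE RE-CUT CURRENCY ON THE COMPLEX WINDOW `closedBall (0:ℂ) 1` with `ref = Re` (`reRef`):
   `not_realBase_linExp_closedBall` (v1.1's shape FAILS there for `c ≠ 0`: at `U₀ = i` the exponent `−c·i·z` is not real on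
   `(0,1]`), `realBaseAt_linExp_closedBall`, `exponentSliceAt_linExp_closedBall` (`c = s/5`, `Ω = ball 0 3`, oscillation
   `(s/5)·‖U₀ + t − Re U₀‖·|z| ≤ s`), `weightSlice_linExp_closedBall`, the supplier's conclusion at `s = 1` with `a = e³`, and
   `linExp_slice_not_const` (the witness MOVES along slices — excluded by §9 for v1.1 inhabitants at interior points).

LOCATED READING for the row (census, [cell], NOT asserted).  With this file, §L's five operation binders reduce — for an
operation that IS the normalised fluctuation integral — to ONE typed seam per met step, `WeightSlice`, whose content is
(i) the factorisation of the analytically continued density along every birth-chart slice of the thin CURRENT-scale window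
(radius `ϱ b k′ k`, §J/(O6)) into the `t`-independent positive density of the real regular base configuration times
`e^{σ_t}`, `σ_t` HOLOMORPHIC in the chart parameter with `sup|σ_t| ≤ 1` — print: [Balaban1989LargeFieldII] p. 379
ll. −4…−1 / p. 380 ll. 1–2 (structure), (1.65) p. 375 (analyticity in (𝐔,𝐉) on Ũ^c_k), p. 379 (smallness of σ_Q), and
the cell's OPEN G-adv3-21 (smallness of σ_V); (ii) positivity of the base mass `∫ρ₀ > 0` — print: p. 380 "obviously
positive, although it may be very small" (cell GAPS G-adv3-2a L1-pos / G-B16-16: an announced-and-deferred interior-point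
statement, [Balaban1989LargeFieldI] p. 195; G-B16-16 (iii) downgrades it to non-load-bearing for the printed
inequalities — a null domain makes the term vanish — and the same dichotomy applies here: on a null window `wOp` is the
harmless `h z₀`, and `WeightSlice` asks `∫ρ₀ > 0` only where the term is present); (iii) measurability and essential
boundedness of the carried integrands in the fluctuation variables (`h𝒢`, consumer side).  The row NE1′ is NOT closed
and NOT printed as a theorem; its other open inputs are unchanged (record `t4/T4-EST-NE1p-P1.md` §4 (O1)–(O6)).
v1.1 (§7) READS THE SEAM OFF THE EXPONENT, where the printed sentences live: per met step, for weights of exponent form,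
`WeightSlice` ⇐ `RealBase` [reality of the (𝐔,𝐉)-dependent exponent at real regular bases — p. 379 "All the expressions
in the definition (1.71), for the configuration U, are real"; integrability of the unnormalised integrand at (U,0); and
the interior-point clause `μ (support base) > 0` = G-adv3-2a / G-B16-16 EXACTLY, now isolated from the background and
from the exponent] + `ExponentSlice` [holomorphy of the exponent along the slice — (1.65) p. 375 TYPE; oscillation of the
exponent `≤ s ≤ 1` — p. 379 "the first order terms are already small": σ_Q C-B16-5, σ_V OPEN G-adv3-21].  The factor
`e^{−𝒜(U,0)} > 0` of p. 380's "obviously positive" is no longer part of any binder.  Status of the row UNCHANGED.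
v1.2 (§9–§11) RE-CUTS THAT SEAM [cell reading, never asserted]: v1.1 placed the reality clause AT the complex window point — on
the complex-open windows the `ℤ^d` pipeline forces, that makes the exponent background-independent (§9), i.e. v1.1's binders are
inhabited at steps `k ≤ K − 2` only by kernels that do not see (𝐔,𝐉); print places reality at the real regular configuration
(U,0) the complex point is expanded about (p. 379 «the operation for a regular G-valued configuration U, with the additional
small, and possible complex valued, term in the exponential»), which is `RealBaseAt ref` / `ExponentSliceAt ref` with
`ref (𝐔,𝐉) = (U,0)` (§10); the oscillation bound is then `‖𝒜_{(𝐔,𝐉) + tD} − 𝒜_{(U,0)}‖ ≤ s` — p. 379's first-order terms in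
(𝐀′,𝐉) PLUS the chart displacement — still σ_Q C-B16-5 / σ_V OPEN G-adv3-21 in content.  The typed shape of the cell's wall
item (w2) changes from `RealBase`/`ExponentSlice` to the `…At ref` forms; status of the row otherwise UNCHANGED (NOT closed,
NOT printed as a theorem).

PRINTED LOCI (renders `HOME/b2b-balaban-ref1/pages/1989-cmp122-large-field-II/1989-cmp122-large-field-II-pNNN-x2.png`,
journal page = 354 + NNN, READ AS IMAGES by this generation: p025 = p. 379, p026 = p. 380; bold 𝐔, 𝐉, 𝐀′, 𝐓′ = the
analytically extended objects, (U,0) = the real regular base point):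
* [Balaban1989LargeFieldII] p. 379 [PDF 25]: «We consider the analytically extended expressions. In the definition
  (1.71) only the quadratic form in B and the term V(X̃) depend on (𝐔,𝐉). We expand them up to the first order in 𝐀′,𝐉,
  the first order terms are already small.» … «Thus the operation 𝐓′_k(X) can be represented as the operation for a
  regular G-valued configuration U, with the additional small, and possible complex valued, term in the exponential. All
  the expressions in the definition (1.71), for the configuration U, are real, and the» [p. 380 [PDF 26]:] «exponential
  density in the integral is positive. This implies the inequalities |𝐓′_k(X,(𝐔,𝐉))F| = |𝐓′_k(X,(U,0))e^{σ}F| ≤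
  𝐓′_k(X,(U,0))|e^{σ}F| ≤ (𝐓′_k(X,(U,0))1) sup e^{|σ|}|F|, (1.73)  |𝐓′_k(X,(𝐔,𝐉))1| = |𝐓′_k(X,(U,0))e^{σ}| ≥
  𝐓′_k(X,(U,0))e^{−2|σ|} ≥ (𝐓′_k(X,(U,0))1)e^{−2 sup|σ|}, (1.74) where σ is the small term of the first order in 𝐀′, 𝐉,
  and F is a function of the integration variables in the integral (1.71). The expression 𝐓′_k(X,(U,0))1 is obviously
  positive, although it may be very small, hence 𝐓′_k(X,(𝐔,𝐉))1 ≠ 0, and from the above inequalities we obtain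
  |(𝐓′_k(X,(𝐔,𝐉))1)^{−1}𝐓′_k(X,(𝐔,𝐉))F| ≤ e^{3 sup|σ|} sup|F|. (1.75)»
  [cite: Balaban1989LargeFieldII, (1.73)–(1.75) pp.379–380]

LABELS. [printed] = quoted above; [folklore] = elementary measure theory / complex analysis / real arithmetic on abstract
data (the gate's tag); [cell] = the cell's reading (identification of hypothesis shapes with Bałaban's objects — NEVER
asserted in Lean).  No `sorry`, no new axioms.  DICTIONARY [cell] (never asserted): `Z` = the fluctuation bond variables of
one met step with their unnormalised fluctuation measure `μ` carried by the window `D`; `ω_U` = the analytically continued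
density of 𝐓′_k at the complex configuration `U`; `ρ₀` = the density at the real regular base point (U,0) of a slice;
`σ_t` = the printed σ along the slice; `s = sup|σ|`; `wOp ω μ z₀ U` = F ↦ (𝐓′_k(X,(𝐔,𝐉))1)^{−1}𝐓′_k(X,(𝐔,𝐉))F;
(v1.1) `base` = the (𝐔,𝐉)-independent real part of (1.71)'s integrand (characteristic functions and U-independent
exponential factors; δ-functions and the finite sum over `{Ω^c_j ∩ X, Z_j ∩ X}, r` live in `μ`), `𝒜_U` = the
(𝐔,𝐉)-dependent part of its exponent (the quadratic form in B and V(X̃)), `s` = its oscillation along the slice.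
(v1.2) `ref U₀` = the real regular configuration (U,0) about which the complex point (𝐔,𝐉) = `U₀` is expanded; in §10
`s` = the oscillation of the exponent along the slice ABOUT `𝒜_{(U,0)}`.
-/

namespace Literature.MathematicalPhysics.QuantumFieldTheory.Balaban1983to89.T4TrajectoryDensity

open MeasureTheory Set Metric Filter
open Literature.MathematicalPhysics.QuantumFieldTheory.Balaban1983to89.T4TermFormat
open Literature.MathematicalPhysics.QuantumFieldTheory.Balaban1983to89.T4TermFormat.Booking
open Literature.MathematicalPhysics.QuantumFieldTheory.Balaban1983to89.T4GatedBooking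
open Literature.MathematicalPhysics.QuantumFieldTheory.Balaban1983to89.T4PreservedUnderT
open Literature.MathematicalPhysics.QuantumFieldTheory.Balaban1983to89.T4TrajectoryComparison
open Literature.MathematicalPhysics.QuantumFieldTheory.Balaban1983to89.T4TrajectoryModulus

noncomputable section

/-! ## §1 The printed kernels (1.73)–(1.75) at measure level [folklore] -/

section Kernels

variable {Z : Type*} {F : Type*} [NormedAddCommGroup F] [NormedSpace ℂ F]

/-- The complex weight `ρ₀ · e^{σ}` — print: the positive density of the real regular configuration times "the additional
small, and possible complex valued, term in the exponential" (p. 379). [folklore] -/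
def weight (ρ₀ : Z → ℝ) (σ : Z → ℂ) : Z → ℂ := fun z => (ρ₀ z : ℂ) * Complex.exp (σ z)

/-- Unfolding the weight. [folklore] -/
theorem weight_apply (ρ₀ : Z → ℝ) (σ : Z → ℂ) (z : Z) :
    weight ρ₀ σ z = (ρ₀ z : ℂ) * Complex.exp (σ z) := rfl

/-- `‖ρ₀ e^{σ}‖ = |ρ₀| e^{Re σ}`. [folklore] -/
theorem norm_weight (ρ₀ : Z → ℝ) (σ : Z → ℂ) (z : Z) :
    ‖weight ρ₀ σ z‖ = |ρ₀ z| * Real.exp (σ z).re := by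
  rw [weight_apply, norm_mul, Complex.norm_real, Real.norm_eq_abs, Complex.norm_exp]

/-- `Re (ρ₀ e^{σ}) = ρ₀ · Re e^{σ}`. [folklore] -/
theorem re_weight (ρ₀ : Z → ℝ) (σ : Z → ℂ) (z : Z) :
    (weight ρ₀ σ z).re = ρ₀ z * (Complex.exp (σ z)).re := by
  rw [weight_apply, Complex.re_ofReal_mul]

/-- The pointwise half of (1.73): `‖ρ₀ e^{σ}‖ ≤ |ρ₀| e^{s}` for `‖σ‖ ≤ s` ("sup e^{|σ|}"). [folklore] -/
theorem norm_weight_le {ρ₀ : Z → ℝ} {σ : Z → ℂ} {s : ℝ} {z : Z} (hσ : ‖σ z‖ ≤ s) :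
    ‖weight ρ₀ σ z‖ ≤ |ρ₀ z| * Real.exp s := by
  rw [norm_weight]
  exact mul_le_mul_of_nonneg_left (Real.exp_le_exp.mpr ((Complex.re_le_norm _).trans hσ)) (abs_nonneg _)

variable [MeasurableSpace Z] {μ : Measure Z}

/-- Measurability of the weight. [folklore] -/
theorem aestronglyMeasurable_weight {ρ₀ : Z → ℝ} {σ : Z → ℂ} (hρ : AEStronglyMeasurable ρ₀ μ)
    (hσ : AEStronglyMeasurable σ μ) : AEStronglyMeasurable (weight ρ₀ σ) μ :=
  (Complex.continuous_ofReal.comp_aestronglyMeasurable hρ).mul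
    (Complex.continuous_exp.comp_aestronglyMeasurable hσ)

/-- Integrability of the weight: `ρ₀` integrable, `σ` essentially bounded. [folklore] -/
theorem integrable_weight {ρ₀ : Z → ℝ} {σ : Z → ℂ} {s : ℝ} (hρ : Integrable ρ₀ μ)
    (hσm : AEStronglyMeasurable σ μ) (hσ : ∀ᵐ z ∂μ, ‖σ z‖ ≤ s) : Integrable (weight ρ₀ σ) μ :=
  (hρ.norm.mul_const (Real.exp s)).mono' (aestronglyMeasurable_weight hρ.1 hσm)
    (hσ.mono fun z hz => by rw [Real.norm_eq_abs]; exact norm_weight_le hz)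

/-- Integrability of weight × essentially bounded integrand. [folklore] -/
theorem integrable_weight_smul {ρ₀ : Z → ℝ} {σ : Z → ℂ} {s m : ℝ} {h : Z → F} (hρ : Integrable ρ₀ μ)
    (hσm : AEStronglyMeasurable σ μ) (hσ : ∀ᵐ z ∂μ, ‖σ z‖ ≤ s) (hhm : AEStronglyMeasurable h μ)
    (hh : ∀ᵐ z ∂μ, ‖h z‖ ≤ m) : Integrable (fun z => weight ρ₀ σ z • h z) μ :=
  (((hρ.norm.mul_const (Real.exp s)).mul_const m)).mono' ((aestronglyMeasurable_weight hρ.1 hσm).smul hhm)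
    (by
      filter_upwards [hσ, hh] with z hz hhz
      rw [norm_smul, Real.norm_eq_abs]
      exact mul_le_mul (norm_weight_le hz) hhz (norm_nonneg _) (by positivity))

/-- **(1.73) p. 380 [26], INTEGRATED**: *"|𝐓′_k(X,(𝐔,𝐉))F| = |𝐓′_k(X,(U,0))e^{σ}F| ≤ 𝐓′_k(X,(U,0))|e^{σ}F| ≤
(𝐓′_k(X,(U,0))1) sup e^{|σ|}|F|"* — for a nonnegative integrable density `ρ₀` of mass `∫ρ₀`, `‖σ‖ ≤ s` and `‖h‖ ≤ m`
a.e.: `‖∫ ρ₀e^{σ} • h dμ‖ ≤ (∫ρ₀)·e^{s}·m`.  (b02's `B16.ineq173` is the same display over a finite weighted sum.)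
[folklore] [cite: Balaban1989LargeFieldII, (1.73) p.380] -/
theorem norm_integral_weight_smul_le {ρ₀ : Z → ℝ} {σ : Z → ℂ} {s m : ℝ} {h : Z → F}
    (hρ : Integrable ρ₀ μ) (hρ0 : 0 ≤ᵐ[μ] ρ₀) (hσ : ∀ᵐ z ∂μ, ‖σ z‖ ≤ s) (hh : ∀ᵐ z ∂μ, ‖h z‖ ≤ m) :
    ‖∫ z, weight ρ₀ σ z • h z ∂μ‖ ≤ (∫ z, ρ₀ z ∂μ) * Real.exp s * m := by
  have hb : ∀ᵐ z ∂μ, ‖weight ρ₀ σ z • h z‖ ≤ ρ₀ z * (Real.exp s * m) := by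
    filter_upwards [hρ0, hσ, hh] with z h0 hz hhz
    rw [norm_smul]
    calc ‖weight ρ₀ σ z‖ * ‖h z‖ ≤ (|ρ₀ z| * Real.exp s) * m :=
          mul_le_mul (norm_weight_le hz) hhz (norm_nonneg _) (by positivity)
      _ = ρ₀ z * (Real.exp s * m) := by rw [abs_of_nonneg h0]; ring
  calc ‖∫ z, weight ρ₀ σ z • h z ∂μ‖ ≤ ∫ z, ρ₀ z * (Real.exp s * m) ∂μ :=
        norm_integral_le_of_norm_le (hρ.mul_const _) hb
    _ = (∫ z, ρ₀ z ∂μ) * Real.exp s * m := by rw [integral_mul_const]; ring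

/-- **(1.74) p. 380 [26], INTEGRATED**: *"|𝐓′_k(X,(𝐔,𝐉))1| = |𝐓′_k(X,(U,0))e^{σ}| ≥ 𝐓′_k(X,(U,0))e^{−2|σ|} ≥
(𝐓′_k(X,(U,0))1)e^{−2 sup|σ|}"* — for a nonnegative integrable density, `σ` a.e.-measurable with `‖σ‖ ≤ s ≤ 1` a.e.:
`(∫ρ₀)·e^{−2s} ≤ Re ∫ ρ₀e^{σ} dμ`.  The pointwise kernel `e^{−2|σ|} ≤ Re e^{σ}` (`|σ| ≤ 1`) is b02's
`B16.exp_neg_two_norm_le_re_cexp` (CREDITED, imported); `Re` commutes with the Bochner integral (`integral_re`).  The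
smallness `s ≤ 1` is LOAD-BEARING (§6).  (b02's `B16.ineq174` is the same display over a finite weighted sum.)
[folklore] [cite: Balaban1989LargeFieldII, (1.74) p.380] -/
theorem mul_exp_le_re_integral_weight {ρ₀ : Z → ℝ} {σ : Z → ℂ} {s : ℝ} (hρ : Integrable ρ₀ μ)
    (hρ0 : 0 ≤ᵐ[μ] ρ₀) (hσm : AEStronglyMeasurable σ μ) (hσ : ∀ᵐ z ∂μ, ‖σ z‖ ≤ s) (hs : s ≤ 1) :
    (∫ z, ρ₀ z ∂μ) * Real.exp (-(2 * s)) ≤ (∫ z, weight ρ₀ σ z ∂μ).re := by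
  have hint : Integrable (weight ρ₀ σ) μ := integrable_weight hρ hσm hσ
  have hint' : Integrable (fun z => (weight ρ₀ σ z).re) μ := by simpa using hint.re
  have hre : (∫ z, weight ρ₀ σ z ∂μ).re = ∫ z, (weight ρ₀ σ z).re ∂μ := by
    have e := integral_re hint
    simpa using e.symm
  rw [hre, ← integral_mul_const]
  refine integral_mono_ae (hρ.mul_const _) hint' ?_
  filter_upwards [hρ0, hσ] with z h0 hz
  have h1 : ‖σ z‖ ≤ 1 := hz.trans hs
  have hk : Real.exp (-(2 * s)) ≤ (Complex.exp (σ z)).re :=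
    (Real.exp_le_exp.mpr (by linarith)).trans (B16.exp_neg_two_norm_le_re_cexp (σ z) h1)
  rw [re_weight]
  exact mul_le_mul_of_nonneg_left hk h0

/-- (1.74), the consequence print draws: *"hence 𝐓′_k(X,(𝐔,𝐉))1 ≠ 0"* — GIVEN a positive base mass `∫ρ₀ > 0` (print:
*"The expression 𝐓′_k(X,(U,0))1 is obviously positive, although it may be very small"*; the positivity is a HYPOTHESIS
here, cell GAPS G-adv3-2a L1-pos / G-B16-16). [folklore] [cite: Balaban1989LargeFieldII, (1.74) p.380] -/
theorem integral_weight_ne_zero {ρ₀ : Z → ℝ} {σ : Z → ℂ} {s : ℝ} (hρ : Integrable ρ₀ μ)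
    (hρ0 : 0 ≤ᵐ[μ] ρ₀) (hσm : AEStronglyMeasurable σ μ) (hσ : ∀ᵐ z ∂μ, ‖σ z‖ ≤ s) (hs : s ≤ 1)
    (hP : 0 < ∫ z, ρ₀ z ∂μ) : (∫ z, weight ρ₀ σ z ∂μ) ≠ 0 := by
  intro h0
  have h := mul_exp_le_re_integral_weight hρ hρ0 hσm hσ hs
  rw [h0, Complex.zero_re] at h
  exact absurd h (not_le.mpr (mul_pos hP (Real.exp_pos _)))

/-- **(1.75) p. 380 [26], INTEGRATED**: *"from the above inequalities we obtain |(𝐓′_k(X,(𝐔,𝐉))1)^{−1}𝐓′_k(X,(𝐔,𝐉))F| ≤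
e^{3 sup|σ|} sup|F|"* — `‖(∫ρ₀e^{σ})⁻¹ • ∫ρ₀e^{σ}•h‖ ≤ e^{3s}·m`; the real arithmetic is b02's `B16.ineq175` (imported)
with `T1 = ∫ρ₀`. [folklore] [cite: Balaban1989LargeFieldII, (1.75) p.380] -/
theorem norm_ratio_le {ρ₀ : Z → ℝ} {σ : Z → ℂ} {s m : ℝ} {h : Z → F} (hρ : Integrable ρ₀ μ)
    (hρ0 : 0 ≤ᵐ[μ] ρ₀) (hP : 0 < ∫ z, ρ₀ z ∂μ) (hσm : AEStronglyMeasurable σ μ)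
    (hσ : ∀ᵐ z ∂μ, ‖σ z‖ ≤ s) (hs : s ≤ 1) (hh : ∀ᵐ z ∂μ, ‖h z‖ ≤ m) (hm : 0 ≤ m) :
    ‖(∫ z, weight ρ₀ σ z ∂μ)⁻¹ • ∫ z, weight ρ₀ σ z • h z ∂μ‖ ≤ Real.exp (3 * s) * m := by
  rw [norm_smul, norm_inv, inv_mul_eq_div]
  exact B16.ineq175 (∫ z, ρ₀ z ∂μ) s m _ _ hP hm (norm_integral_weight_smul_le hρ hρ0 hσ hh)
    ((mul_exp_le_re_integral_weight hρ hρ0 hσm hσ hs).trans (Complex.re_le_norm _))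

end Kernels

/-! ## §2 The totalised normalised complex-weight operation and its integrand class [folklore] -/

section Operation

variable {Z : Type*} [MeasurableSpace Z] {𝒰 : Type*} {F : Type*} [NormedAddCommGroup F]

/-- THE INTEGRAND CLASS `𝒢` of §L for an honest integral operation: a.e.-strongly measurable and essentially bounded
integrands (§F typing T1). [folklore] -/
def BddClass (F : Type*) [NormedAddCommGroup F] (μ : Measure Z) : Set (Z → F) :=
  {h | AEStronglyMeasurable h μ ∧ ∃ m : ℝ, ∀ᵐ z ∂μ, ‖h z‖ ≤ m}

/-- §L's `h𝒢c`: the constants are in the class. [folklore] -/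
theorem const_mem_bddClass (μ : Measure Z) (c : F) : (fun _ : Z => c) ∈ BddClass F μ :=
  ⟨aestronglyMeasurable_const, ‖c‖, Eventually.of_forall fun _ => le_rfl⟩

/-- §L's `h𝒢s`: the class is closed under differences. [folklore] -/
theorem sub_mem_bddClass {μ : Measure Z} {g g' : Z → F} (hg : g ∈ BddClass F μ) (hg' : g' ∈ BddClass F μ) :
    g - g' ∈ BddClass F μ := by
  obtain ⟨hgm, m, hm⟩ := hg
  obtain ⟨hg'm, m', hm'⟩ := hg'
  refine ⟨hgm.sub hg'm, m + m', ?_⟩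
  filter_upwards [hm, hm'] with z hz hz'
  exact (norm_sub_le _ _).trans (add_le_add hz hz')

variable [NormedSpace ℂ F]

/-- An integrable complex weight times a class member is integrable. [folklore] -/
theorem integrable_smul_of_mem_bddClass {μ : Measure Z} {W : Z → ℂ} (hW : Integrable W μ) {g : Z → F}
    (hg : g ∈ BddClass F μ) : Integrable (fun z => W z • g z) μ := by
  obtain ⟨hgm, m, hm⟩ := hg
  exact (hW.norm.mul_const m).mono' (hW.1.smul hgm)
    (hm.mono fun z hz => by rw [norm_smul]; exact mul_le_mul_of_nonneg_left hz (norm_nonneg _))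

open Classical in
/-- **THE NORMALISED COMPLEX-WEIGHT OPERATION, TOTALISED**: `wOp ω μ z₀ U h = (∫ ω_U dμ)⁻¹ • ∫ ω_U • h dμ` whenever the
weight `ω_U` is integrable with non-zero integral (the good set — every point of an analyticity window, §3), and the
harmless evaluation `h z₀` elsewhere, so that §L's `hnorm` and `hsub` hold at EVERY `U : 𝒰` (`wOp_const`, `wOp_sub`).
[cell, never asserted: `F ↦ (𝐓′_k(X,(𝐔,𝐉))1)^{−1}𝐓′_k(X,(𝐔,𝐉))F` of (1.75) p. 380.] [folklore] -/
def wOp (ω : 𝒰 → Z → ℂ) (μ : Measure Z) (z₀ : Z) (U : 𝒰) (h : Z → F) : F :=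
  if Integrable (ω U) μ ∧ (∫ z, ω U z ∂μ) ≠ 0 then (∫ z, ω U z ∂μ)⁻¹ • ∫ z, ω U z • h z ∂μ else h z₀

variable {ω : 𝒰 → Z → ℂ} {μ : Measure Z} {z₀ : Z} {U : 𝒰}

/-- On the good set `wOp` is the normalised weighted integral. [folklore] -/
theorem wOp_of_pos (hi : Integrable (ω U) μ) (hne : (∫ z, ω U z ∂μ) ≠ 0) (h : Z → F) :
    wOp ω μ z₀ U h = (∫ z, ω U z ∂μ)⁻¹ • ∫ z, ω U z • h z ∂μ := by
  unfold wOp; rw [if_pos ⟨hi, hne⟩]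

/-- Off the good set `wOp` is evaluation at `z₀`. [folklore] -/
theorem wOp_of_neg (hn : ¬ (Integrable (ω U) μ ∧ (∫ z, ω U z ∂μ) ≠ 0)) (h : Z → F) :
    wOp ω μ z₀ U h = h z₀ := by
  unfold wOp; rw [if_neg hn]

/-- §L's `hsub`: **SUBTRACTIVE ON THE CLASS at every `U`** (linearity of the Bochner integral on integrable integrands —
exactly what the class guard of §L buys; cf. `T4TrajectoryModulus.setIntegral_not_subtractive`). [folklore] -/
theorem wOp_sub (ω : 𝒰 → Z → ℂ) (μ : Measure Z) (z₀ : Z) (U : 𝒰) {g g' : Z → F}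
    (hg : g ∈ BddClass F μ) (hg' : g' ∈ BddClass F μ) :
    wOp ω μ z₀ U (g - g') = wOp ω μ z₀ U g - wOp ω μ z₀ U g' := by
  by_cases hc : Integrable (ω U) μ ∧ (∫ z, ω U z ∂μ) ≠ 0
  · rw [wOp_of_pos hc.1 hc.2, wOp_of_pos hc.1 hc.2, wOp_of_pos hc.1 hc.2, ← smul_sub,
      ← integral_sub (integrable_smul_of_mem_bddClass hc.1 hg) (integrable_smul_of_mem_bddClass hc.1 hg')]
    congr 1
    refine integral_congr_ae (Eventually.of_forall fun z => ?_)
    simp [smul_sub]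
  · rw [wOp_of_neg hc, wOp_of_neg hc, wOp_of_neg hc, Pi.sub_apply]

variable [CompleteSpace F]

/-- §L's `hnorm`: **NORMALISED at every `U`**. [folklore] -/
theorem wOp_const (ω : 𝒰 → Z → ℂ) (μ : Measure Z) (z₀ : Z) (U : 𝒰) (c : F) :
    wOp ω μ z₀ U (fun _ => c) = c := by
  by_cases hc : Integrable (ω U) μ ∧ (∫ z, ω U z ∂μ) ≠ 0
  · rw [wOp_of_pos hc.1 hc.2, integral_smul_const, smul_smul, inv_mul_cancel₀ hc.2, one_smul]
  · exact wOp_of_neg hc _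

end Operation

/-! ## §3 The weight slice (printed TYPE, NOT asserted) and THE SUPPLIER of §L's `OpSliceOn` -/

section Supplier

open T4BirthChartTransport (BirthSlice)

variable {Z : Type*} [MeasurableSpace Z] {𝒰 Dir : Type*}
  {F : Type*} [NormedAddCommGroup F] [NormedSpace ℂ F]

/-- HYPOTHESIS SHAPE — **THE WEIGHT SLICE** (printed TYPE of pp. 379–380, typed along §J's birth-chart slices of the thin
current-scale window; NOT asserted).  For every regular base `U₀ ∈ 𝒦` and admissible direction `d` (`0 < N d ≤ w`) there
is an OPEN `Ω ⊆ ℂ` containing the closed discs of radius `ϱ / N d` about `[0,1]`, a `t`-INDEPENDENT density `ρ₀ ≥ 0`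
a.e., integrable, of positive mass (*"the operation for a regular G-valued configuration U … the exponential density in
the integral is positive"*, *"obviously positive"*), and exponents `σ_t`, a.e.-strongly measurable, HOLOMORPHIC in `t ∈ Ω`
for a.e. `z`, bounded `‖σ_t(z)‖ ≤ s` (*"the additional small, and possible complex valued, term in the exponential"*), with
`ω_{move U₀ d t} = ρ₀ · e^{σ_t}` a.e. for every `t ∈ Ω`.  [cell reading, never asserted: the factorisation is p. 379's
first-order expansion in (𝐀′,𝐉) around (U,0); holomorphy in `t` is (1.65) p. 375 / [IV] (1.89) restricted to the slice;
the bound `s` is p. 379 for σ_Q and the cell's OPEN G-adv3-21 for σ_V.] [folklore] -/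
def WeightSlice (ω : 𝒰 → Z → ℂ) (μ : Measure Z) (move : 𝒰 → Dir → ℂ → 𝒰) (N : Dir → ℝ) (𝒦 : Set 𝒰)
    (w ϱ s : ℝ) : Prop :=
  ∀ U₀ ∈ 𝒦, ∀ d : Dir, 0 < N d → N d ≤ w →
    ∃ Ω : Set ℂ, IsOpen Ω ∧ (∀ x ∈ Icc (0 : ℝ) 1, closedBall (x : ℂ) (ϱ / N d) ⊆ Ω) ∧
      ∃ ρ₀ : Z → ℝ, 0 ≤ᵐ[μ] ρ₀ ∧ Integrable ρ₀ μ ∧ 0 < ∫ z, ρ₀ z ∂μ ∧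
        ∃ σ : ℂ → Z → ℂ, (∀ t ∈ Ω, AEStronglyMeasurable (σ t) μ) ∧
          (∀ᵐ z ∂μ, DifferentiableOn ℂ (fun t => σ t z) Ω) ∧ (∀ᵐ z ∂μ, ∀ t ∈ Ω, ‖σ t z‖ ≤ s) ∧
          ∀ t ∈ Ω, ω (move U₀ d t) =ᵐ[μ] weight ρ₀ (σ t)

variable {ω : 𝒰 → Z → ℂ} {μ : Measure Z} {move : 𝒰 → Dir → ℂ → 𝒰} {N : Dir → ℝ} {𝒦 : Set 𝒰}
  {w ϱ s : ℝ} {D : Set Z}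

/-- **THE SUPPLIER — §L's `hop` FROM THE PRINTED MECHANISM.**  A weight slice with `sup|σ| ≤ s ≤ 1` and a window `D`
of full measure give `OpSliceOn (BddClass F μ) (wOp ω μ z₀) D move N 𝒦 w ϱ (e^{3s})`: for `h` in the class with
`‖h‖ ≤ m` on `D`, the slice `t ↦ wOp ω μ z₀ (move U₀ d t) h` is, on the open `Ω` of the weight slice, the quotient of the
two dominated holomorphic parameter integrals `∫ρ₀e^{σ_t}•h dμ` and `∫ρ₀e^{σ_t} dμ`
(`Literature.Analysis.Complex.differentiableOn_integral_of_dominated`, majorants `|ρ₀|e^{s}m`, `|ρ₀|e^{s}`), the denominator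
non-vanishing by (1.74) (`integral_weight_ne_zero`), hence holomorphic there, and bounded by `e^{3s}·m` by (1.75)
(`norm_ratio_le`); `Ω` contains the closed discs of radius `ϱ / N d` about `[0,1]`. [folklore] -/
theorem opSliceOn_wOp (z₀ : Z) (hws : WeightSlice ω μ move N 𝒦 w ϱ s) (hs : s ≤ 1)
    (hD : ∀ᵐ z ∂μ, z ∈ D) :
    OpSliceOn (BddClass F μ) (wOp ω μ z₀) D move N 𝒦 w ϱ (Real.exp (3 * s)) := by
  intro h hh m hm U₀ hU₀ d hd hdw
  obtain ⟨Ω, hΩ, hballs, ρ₀, hρ0, hρ, hP, σ, hσm, hσd, hσb, hfac⟩ := hws U₀ hU₀ d hd hdw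
  have hhm : AEStronglyMeasurable h μ := hh.1
  have hhb : ∀ᵐ z ∂μ, ‖h z‖ ≤ m := hD.mono fun z hz => hm z hz
  have hμ : μ ≠ 0 := by
    intro h0; rw [h0, integral_zero_measure] at hP; exact lt_irrefl _ hP
  have hm0 : 0 ≤ m := by
    haveI : (ae μ).NeBot := ae_neBot.mpr hμ
    obtain ⟨z, hz⟩ := hhb.exists
    exact (norm_nonneg _).trans hz
  have hσb' : ∀ t ∈ Ω, ∀ᵐ z ∂μ, ‖σ t z‖ ≤ s := fun t ht => hσb.mono fun z hz => hz t ht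
  have hWint : ∀ t ∈ Ω, Integrable (weight ρ₀ (σ t)) μ := fun t ht =>
    integrable_weight hρ (hσm t ht) (hσb' t ht)
  have hωint : ∀ t ∈ Ω, Integrable (ω (move U₀ d t)) μ := fun t ht =>
    (hWint t ht).congr (hfac t ht).symm
  have hωW : ∀ t ∈ Ω, ∫ z, ω (move U₀ d t) z ∂μ = ∫ z, weight ρ₀ (σ t) z ∂μ := fun t ht =>
    integral_congr_ae (hfac t ht)
  have hωWh : ∀ t ∈ Ω, ∫ z, ω (move U₀ d t) z • h z ∂μ = ∫ z, weight ρ₀ (σ t) z • h z ∂μ :=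
    fun t ht => integral_congr_ae ((hfac t ht).mono fun z hz => by simp only [hz])
  have hne : ∀ t ∈ Ω, (∫ z, weight ρ₀ (σ t) z ∂μ) ≠ 0 := fun t ht =>
    integral_weight_ne_zero hρ hρ0 (hσm t ht) (hσb' t ht) hs hP
  have hE : ∀ t ∈ Ω, wOp ω μ z₀ (move U₀ d t) h =
      (∫ z, weight ρ₀ (σ t) z ∂μ)⁻¹ • ∫ z, weight ρ₀ (σ t) z • h z ∂μ := by
    intro t ht
    rw [wOp_of_pos (hωint t ht) (by rw [hωW t ht]; exact hne t ht), hωW t ht, hωWh t ht]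
  refine ⟨Ω, ?_, ?_, hballs⟩
  · have hG : DifferentiableOn ℂ (fun t => ∫ z, weight ρ₀ (σ t) z ∂μ) Ω := by
      refine Literature.Analysis.Complex.differentiableOn_integral_of_dominated
        (fun t ht => aestronglyMeasurable_weight hρ.1 (hσm t ht)) ?_ ?_
      · filter_upwards [hσd] with z hz
        exact (hz.cexp.const_mul (ρ₀ z : ℂ))
      · intro t₀ ht₀
        obtain ⟨R, hR, hRΩ⟩ := Metric.isOpen_iff.mp hΩ t₀ ht₀
        refine ⟨R, hR, hRΩ, fun z => ‖ρ₀ z‖ * Real.exp s, hρ.norm.mul_const _, ?_⟩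
        filter_upwards [hσb] with z hz t ht
        rw [Real.norm_eq_abs]
        exact norm_weight_le (hz t (hRΩ ht))
    have hH : DifferentiableOn ℂ (fun t => ∫ z, weight ρ₀ (σ t) z • h z ∂μ) Ω := by
      refine Literature.Analysis.Complex.differentiableOn_integral_of_dominated
        (fun t ht => (aestronglyMeasurable_weight hρ.1 (hσm t ht)).smul hhm) ?_ ?_
      · filter_upwards [hσd] with z hz
        exact (hz.cexp.const_mul (ρ₀ z : ℂ)).smul_const (h z)
      · intro t₀ ht₀
        obtain ⟨R, hR, hRΩ⟩ := Metric.isOpen_iff.mp hΩ t₀ ht₀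
        refine ⟨R, hR, hRΩ, fun z => ‖ρ₀ z‖ * Real.exp s * m, (hρ.norm.mul_const _).mul_const _, ?_⟩
        filter_upwards [hσb, hhb] with z hz hhz t ht
        rw [norm_smul, Real.norm_eq_abs]
        exact mul_le_mul (norm_weight_le (hz t (hRΩ ht))) hhz (norm_nonneg _) (by positivity)
    exact ((hG.inv hne).smul hH).congr fun t ht => hE t ht
  · intro t ht
    show ‖wOp ω μ z₀ (move U₀ d t) h‖ ≤ _
    rw [hE t ht]
    exact norm_ratio_le hρ hρ0 hP (hσm t ht) (hσb' t ht) hs hhb hm0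

end Supplier

/-! ## §4 Consumption by §L, BY NAME: the guarded step law and the pipelines fed by weight slices -/

section Consumption

open T4BirthChartTransport (GaugeInvariant BirthSlice RelGauge)

variable {B : Booking} {T : Trajectory B}
variable {Z : Type*} [MeasurableSpace Z] {𝒰 Dir : Type*}
  {F : Type*} [NormedAddCommGroup F] [NormedSpace ℂ F] [CompleteSpace F]
  {move : 𝒰 → Dir → ℂ → 𝒰} {N : Dir → ℝ} {w r : ℝ}

/-- **§L's CLASS- AND WINDOW-GUARDED STEP LAW FROM A WEIGHT SLICE** — `T4TrajectoryModulus.contStepLawOn_of_linearOpSliceOn_windowed`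
with its five operation binders `h𝒢c`, `h𝒢s`, `hsub`, `hnorm`, `hop` DISCHARGED for the operation `wOp ω μ z₀` on the class
`BddClass F μ` (§2–§3); constants `a = e^{3s}`, `C = 4e^{3s}/ϱ`; the chart-action binders `hcov`/`hpair` stay hypotheses
(§K discharges them on `ℤ^d`). [folklore] -/
theorem contStepLawOn_wOp {ω : 𝒰 → Z → ℂ} {μ : Measure Z} {z₀ : Z} {act : Z → 𝒰 → 𝒰} {D : Set Z}
    {𝒦 : Set 𝒰} {Adm' : 𝒰 → 𝒰 → ℝ → Prop} {ϱ s θ : ℝ}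
    (hD : D.Nonempty) (hϱ : 0 < ϱ) (hmove : ∀ U d, move U d 0 = U) (hdir : ∃ d : Dir, 0 < N d ∧ N d ≤ w)
    (hws : WeightSlice ω μ move N 𝒦 w ϱ s) (hs : s ≤ 1) (hDμ : ∀ᵐ z ∂μ, z ∈ D)
    (hcov : ∀ (U₀ U₁ : 𝒰) (δ : ℝ), RawAdm move N 𝒦 U₀ U₁ δ → δ ≤ w → ∀ z ∈ D, Adm' (act z U₀) (act z U₁) δ)
    (hpair : ∀ (U₀ U₁ : 𝒰) (δ : ℝ), RawAdm move N 𝒦 U₀ U₁ δ → δ ≤ w → ∀ z ∈ D, ∀ z' ∈ D, z ≠ z' →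
      Adm' (act z' U₁) (act z U₁) θ)
    (hθ0 : 0 ≤ θ) (hθw : θ ≤ w) :
    ContStepLawOn (BddClass F μ) (wOp ω μ z₀) act D (Windowed (RawAdm move N 𝒦) w) Adm' w (Real.exp (3 * s))
      (4 * Real.exp (3 * s) / ϱ) θ :=
  contStepLawOn_of_linearOpSliceOn_windowed hD hϱ hmove hdir (const_mem_bddClass μ)
    (fun _ hg _ hg' => sub_mem_bddClass hg hg') (fun U _ hg _ hg' => wOp_sub ω μ z₀ U hg hg')
    (wOp_const ω μ z₀) (opSliceOn_wOp z₀ hws hs hDμ) hcov hpair hθ0 hθw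

/-- **THE DRESSED PIPELINE FED BY WEIGHT SLICES (windowed, abstract configurations)** —
`T4TrajectoryModulus.transportsFromVar_of_linearOpSlicesOn_windowed` VERBATIM except that, per met step `k`, the step
operation IS `wOp (ω k) (μ k) (z₀ k)` on the class `BddClass F (μ k)` and its five binders are REPLACED by one weight slice
`hws` with `s k ≤ 1` and a window `D k` of full `μ k`-measure; the operator constant is the PRINTED `a k = e^{3 s_k}` of
(1.75), so the domination reads `e^{3 s_k}·(1 + 4θ/ϱ) ≤ α k`.  SAME conclusion `T.TransportsFromVar (4c_δ/r) (fun i => ψ·α i) Gate`.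
Births `hsl`, recursion `hFn` (now literally "the next carried function is the normalised weighted fluctuation integral of
the previous one" ON THE GOOD SET of §2 — off it `wOp` is the total junk value `h z₀`, a branch never met on an
analyticity window (§3); the consumer's modelling burden is that of §L's toy), class membership `h𝒢` (measurability
and essential boundedness in the fluctuation variables), chart geometry, invariance, defects, attainment: unchanged
hypotheses. [folklore] -/
theorem transportsFromVar_of_weightSlices_windowed {Gate : ℕ → Prop}
    {Fn : B.Birth → ℕ → ℕ → 𝒰 → F}
    {rel : B.Birth → ℕ → ℕ → 𝒰 → 𝒰 → Prop} {Nk : B.Birth → ℕ → ℕ → Dir → ℝ} {𝒦 : B.Birth → ℕ → ℕ → Set 𝒰}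
    {ωk : ℕ → 𝒰 → Z → ℂ} {μ : ℕ → Measure Z} {z₀ : ℕ → Z} {act : ℕ → Z → 𝒰 → 𝒰} {D : ℕ → Set Z}
    {defect : B.Birth → ℕ → ℕ → ℝ} {cδ ψ : ℝ} {s α : ℕ → ℝ} {ϱ θ : B.Birth → ℕ → ℕ → ℝ}
    (hα : ∀ i, 0 ≤ α i) (hr : 0 < r) (hmove : ∀ U d, move U d 0 = U)
    (hsl : ∀ (b : B.Birth) (k' : ℕ), B.birthScale b ≤ k' → k' ≤ B.K → RanBelow Gate k' →
      BirthSlice (Fn b k' k') move (Nk b k' k') (𝒦 b k' k') w r (T.gen b k'))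
    (hFn : ∀ (b : B.Birth) (k' k : ℕ), B.birthScale b ≤ k' → k' ≤ k → k + 1 ≤ B.K → RanBelow Gate (k + 1) →
      ∀ U, Fn b k' (k + 1) U = wOp (ωk k) (μ k) (z₀ k) U (fun z => Fn b k' k (act k z U)))
    (h𝒢 : ∀ (b : B.Birth) (k' k : ℕ), B.birthScale b ≤ k' → k' ≤ k → k + 1 ≤ B.K → RanBelow Gate (k + 1) →
      ∀ U, (fun z => Fn b k' k (act k z U)) ∈ BddClass F (μ k))
    (hD : ∀ k, (D k).Nonempty) (hϱ : ∀ b k' k, 0 < ϱ b k' k)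
    (hws : ∀ (b : B.Birth) (k' k : ℕ), B.birthScale b ≤ k' → k' ≤ k → k + 1 ≤ B.K → RanBelow Gate (k + 1) →
      WeightSlice (ωk k) (μ k) move (Nk b k' (k + 1)) (𝒦 b k' (k + 1)) w (ϱ b k' k) (s k))
    (hs : ∀ k, s k ≤ 1) (hDμ : ∀ k, ∀ᵐ z ∂μ k, z ∈ D k)
    (hdir : ∀ (b : B.Birth) (k' k : ℕ), B.birthScale b ≤ k' → k' ≤ k → k + 1 ≤ B.K →
      ∃ d : Dir, 0 < Nk b k' (k + 1) d ∧ Nk b k' (k + 1) d ≤ w)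
    (hcov : ∀ (b : B.Birth) (k' k : ℕ), B.birthScale b ≤ k' → k' ≤ k → k + 1 ≤ B.K → RanBelow Gate (k + 1) →
      ∀ (U₀ U₁ : 𝒰) (δ : ℝ), RawAdm move (Nk b k' (k + 1)) (𝒦 b k' (k + 1)) U₀ U₁ δ → δ ≤ w → ∀ z ∈ D k,
        RawAdm move (Nk b k' k) (𝒦 b k' k) (act k z U₀) (act k z U₁) δ)
    (hpair : ∀ (b : B.Birth) (k' k : ℕ), B.birthScale b ≤ k' → k' ≤ k → k + 1 ≤ B.K → RanBelow Gate (k + 1) →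
      ∀ (U₀ U₁ : 𝒰) (δ : ℝ), RawAdm move (Nk b k' (k + 1)) (𝒦 b k' (k + 1)) U₀ U₁ δ → δ ≤ w →
        ∀ z ∈ D k, ∀ z' ∈ D k, z ≠ z' → RawAdm move (Nk b k' k) (𝒦 b k' k) (act k z' U₁) (act k z U₁) (θ b k' k))
    (hθ : ∀ b k' k, 0 ≤ θ b k' k ∧ θ b k' k ≤ w)
    (hdom : ∀ (b : B.Birth) (k' k : ℕ), B.birthScale b ≤ k' → k' ≤ k → k + 1 ≤ B.K →
      Real.exp (3 * s k) * (1 + 4 * θ b k' k / ϱ b k' k) ≤ α k)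
    (hinv : ∀ b k' k, GaugeInvariant (rel b k' k) (Fn b k' k))
    (hdefw : ∀ b k' k, defect b k' k ≤ w)
    (hrate : ∀ (b : B.Birth) (k' k : ℕ), B.birthScale b ≤ k' → k' ≤ k → k ≤ B.K →
      defect b k' k ≤ cδ * ψ ^ (k - k'))
    (hlin : ∀ (b : B.Birth) (k' k : ℕ), B.birthScale b ≤ k' → k' ≤ k → k ≤ B.K → RanBelow Gate k → ∀ ε > 0,
      ∃ U₀ ∈ 𝒦 b k' k, ∃ U₁ : 𝒰, RelGauge (rel b k' k) move (Nk b k' k) U₀ U₁ (defect b k' k) ∧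
        T.lin b k' k ≤ ‖Fn b k' k U₁ - Fn b k' k U₀‖ + ε) :
    T.TransportsFromVar (4 * cδ / r) (fun i => ψ * α i) Gate :=
  transportsFromVar_of_linearOpSlicesOn_windowed (𝒢 := fun k => BddClass F (μ k))
    (E := fun k => wOp (ωk k) (μ k) (z₀ k)) (a := fun k => Real.exp (3 * s k)) (ϱ := ϱ) (ω := θ)
    hα hr hmove hsl hFn h𝒢 hD hϱ (fun k c => const_mem_bddClass (μ k) c)
    (fun _ _ hg _ hg' => sub_mem_bddClass hg hg') (fun k U _ hg _ hg' => wOp_sub (ωk k) (μ k) (z₀ k) U hg hg')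
    (fun k U c => wOp_const (ωk k) (μ k) (z₀ k) U c)
    (fun b k' k hbk' hk'k hk hran => opSliceOn_wOp (z₀ k) (hws b k' k hbk' hk'k hk hran) (hs k) (hDμ k))
    hdir hcov hpair hθ hdom hinv hdefw hrate hlin

end Consumption

section ConsumptionLattice

open T4BirthChartTransport (GaugeInvariant BirthSlice RelGauge)
open T4BlockTransport (Fld NDir latMove latN)

variable {B : Booking} {T : Trajectory B}
variable {R : Type*} [NormedRing R] [NormedAlgebra ℂ R] [MeasurableSpace R] {d : ℕ}
  {F : Type*} [NormedAddCommGroup F] [NormedSpace ℂ F] [CompleteSpace F]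

/-- **THE DRESSED PIPELINE FED BY WEIGHT SLICES ON `ℤ^d`** (= row O3.E-iii-c's located consumer target in weight-slice
form) — `T4TrajectoryModulus.transportsFromVar_of_linearOpSlicesOn_lattice` VERBATIM (nestings (N1)/(N2), diameter (DIAM),
births, invariance, defects, attainment) except that, per met step `k`, the step operation IS `wOp (ω k) (μ k) (z₀ k)` —
`μ k` a measure on the bond fields `Fld d R` (any measurable structure on `R`) — on the class `BddClass F (μ k)`, fed by one
weight slice along the lattice chart `latMove`/`latN` with `s k ≤ 1` and `D k` of full measure; `a k = e^{3 s_k}`.  SAME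
conclusion. [folklore] -/
theorem transportsFromVar_of_weightSlices_lattice {Gate : ℕ → Prop} {Fn : B.Birth → ℕ → ℕ → Fld d R → F}
    {rel : B.Birth → ℕ → ℕ → Fld d R → Fld d R → Prop} {𝒦 : B.Birth → ℕ → ℕ → Set (Fld d R)}
    {ω : ℕ → Fld d R → Fld d R → ℂ} {μ : ℕ → Measure (Fld d R)} {z₀ : ℕ → Fld d R} {D : ℕ → Set (Fld d R)}
    {defect : B.Birth → ℕ → ℕ → ℝ} {cδ ψ w r : ℝ} {s α θ : ℕ → ℝ} {ϱ : B.Birth → ℕ → ℕ → ℝ}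
    (hα : ∀ i, 0 ≤ α i) (hr : 0 < r) (hw : 0 < w)
    (hsl : ∀ (b : B.Birth) (k' : ℕ), B.birthScale b ≤ k' → k' ≤ B.K → RanBelow Gate k' →
      BirthSlice (Fn b k' k') latMove latN (𝒦 b k' k') w r (T.gen b k'))
    (hFn : ∀ (b : B.Birth) (k' k : ℕ), B.birthScale b ≤ k' → k' ≤ k → k + 1 ≤ B.K → RanBelow Gate (k + 1) →
      ∀ U, Fn b k' (k + 1) U = wOp (ω k) (μ k) (z₀ k) U (fun z => Fn b k' k (U + z)))
    (h𝒢 : ∀ (b : B.Birth) (k' k : ℕ), B.birthScale b ≤ k' → k' ≤ k → k + 1 ≤ B.K → RanBelow Gate (k + 1) →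
      ∀ U, (fun z => Fn b k' k (U + z)) ∈ BddClass F (μ k))
    (hD : ∀ k, (D k).Nonempty) (hϱ : ∀ b k' k, 0 < ϱ b k' k)
    (hws : ∀ (b : B.Birth) (k' k : ℕ), B.birthScale b ≤ k' → k' ≤ k → k + 1 ≤ B.K → RanBelow Gate (k + 1) →
      WeightSlice (ω k) (μ k) latMove latN (𝒦 b k' (k + 1)) w (ϱ b k' k) (s k))
    (hs : ∀ k, s k ≤ 1) (hDμ : ∀ k, ∀ᵐ z ∂μ k, z ∈ D k)
    (hN1 : ∀ (b : B.Birth) (k' k : ℕ), B.birthScale b ≤ k' → k' ≤ k → k + 1 ≤ B.K →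
      ∀ z ∈ D k, ∀ U ∈ 𝒦 b k' (k + 1), U + z ∈ 𝒦 b k' k)
    (hN2 : ∀ (b : B.Birth) (k' k : ℕ), B.birthScale b ≤ k' → k' ≤ k → k + 1 ≤ B.K →
      ∀ U₀ ∈ 𝒦 b k' (k + 1), ∀ p : NDir d R, latN p ≤ w → ∀ z' ∈ D k, latMove U₀ p 1 + z' ∈ 𝒦 b k' k)
    (hdiam : ∀ k, ∀ z ∈ D k, ∀ z' ∈ D k, ∀ x ν, ‖z x ν - z' x ν‖ ≤ θ k)
    (hθ : ∀ k, 0 < θ k ∧ θ k ≤ w)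
    (hdom : ∀ (b : B.Birth) (k' k : ℕ), B.birthScale b ≤ k' → k' ≤ k → k + 1 ≤ B.K →
      Real.exp (3 * s k) * (1 + 4 * θ k / ϱ b k' k) ≤ α k)
    (hinv : ∀ b k' k, GaugeInvariant (rel b k' k) (Fn b k' k))
    (hdefw : ∀ b k' k, defect b k' k ≤ w)
    (hrate : ∀ (b : B.Birth) (k' k : ℕ), B.birthScale b ≤ k' → k' ≤ k → k ≤ B.K →
      defect b k' k ≤ cδ * ψ ^ (k - k'))
    (hlin : ∀ (b : B.Birth) (k' k : ℕ), B.birthScale b ≤ k' → k' ≤ k → k ≤ B.K → RanBelow Gate k → ∀ ε > 0,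
      ∃ U₀ ∈ 𝒦 b k' k, ∃ U₁ : Fld d R, RelGauge (rel b k' k) latMove latN U₀ U₁ (defect b k' k) ∧
        T.lin b k' k ≤ ‖Fn b k' k U₁ - Fn b k' k U₀‖ + ε) :
    T.TransportsFromVar (4 * cδ / r) (fun i => ψ * α i) Gate :=
  transportsFromVar_of_linearOpSlicesOn_lattice (𝒢 := fun k => BddClass F (μ k))
    (E := fun k => wOp (ω k) (μ k) (z₀ k)) (a := fun k => Real.exp (3 * s k)) (ϱ := ϱ) (ω := θ)
    hα hr hw hsl hFn h𝒢 hD hϱ (fun k c => const_mem_bddClass (μ k) c)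
    (fun _ _ hg _ hg' => sub_mem_bddClass hg hg') (fun k U _ hg _ hg' => wOp_sub (ω k) (μ k) (z₀ k) U hg hg')
    (fun k U c => wOp_const (ω k) (μ k) (z₀ k) U c)
    (fun b k' k hbk' hk'k hk hran => opSliceOn_wOp (z₀ k) (hws b k' k hbk' hk'k hk hran) (hs k) (hDμ k))
    hN1 hN2 hdiam hθ hdom hinv hdefw hrate hlin

end ConsumptionLattice

/-! ## §5 Non-vacuity: a weight slice with GENUINE background dependence (toy; nothing of Bałaban's modelled) -/

section Witness

open T4BirthChartTransport (BirthSlice)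

/-- The toy weights `ω_U(z) = e^{c·U·z}` on `[0,1]` — they DEPEND on the (complex) background `U`. [folklore] -/
def expLin (c : ℝ) (U : ℂ) (z : ℝ) : ℂ := Complex.exp ((c : ℂ) * U * (z : ℂ))

/-- **NON-VACUITY OF THE WEIGHT SLICE.**  On `([0,1], Lebesgue)` with `𝒰 = ℂ`, `move U _ t = U + t`, unit window norm,
`𝒦 = closedBall 0 1`, `w = ϱ = 1`: the weights `expLin (s/4)` form a weight slice of size `s`, for every `s ≥ 0` —
`Ω = ball 0 3` (open, contains the unit discs about `[0,1]`), `ρ₀ = 1` (mass `1 > 0`), `σ_t(z) = (s/4)(U₀ + t)z`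
(holomorphic in `t`, continuous in `z`, `|σ_t(z)| ≤ (s/4)·4·1` on `Ω × [0,1]`), exact factorisation. [folklore] -/
theorem weightSlice_expLin {s : ℝ} (hs : 0 ≤ s) :
    WeightSlice (Dir := Unit) (expLin (s / 4)) (volume.restrict (Icc (0 : ℝ) 1)) (fun U _ t => U + t)
      (fun _ => 1) (closedBall (0 : ℂ) 1) 1 1 s := by
  intro U₀ hU₀ d _ _
  rw [mem_closedBall, dist_zero_right] at hU₀
  refine ⟨ball 0 3, isOpen_ball, ?_, fun _ => 1, Eventually.of_forall fun _ => zero_le_one, ?_, ?_,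
    fun t z => ((s / 4 : ℝ) : ℂ) * (U₀ + t) * (z : ℂ), ?_, ?_, ?_, ?_⟩
  · intro x hx t ht
    rw [mem_closedBall, dist_eq_norm] at ht
    rw [mem_ball, dist_zero_right]
    have hx' : ‖(x : ℂ)‖ ≤ 1 := by
      rw [Complex.norm_real, Real.norm_eq_abs, abs_le]; constructor <;> linarith [hx.1, hx.2]
    calc ‖t‖ = ‖(t - x) + x‖ := by rw [sub_add_cancel]
      _ ≤ ‖t - (x : ℂ)‖ + ‖(x : ℂ)‖ := norm_add_le _ _
      _ ≤ 1 / 1 + 1 := add_le_add ht hx'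
      _ < 3 := by norm_num
  · exact integrableOn_const (hs := measure_Icc_lt_top.ne)
  · rw [setIntegral_const, Real.volume_real_Icc_of_le zero_le_one]; norm_num
  · intro t _
    exact (Continuous.aestronglyMeasurable (by fun_prop))
  · exact Eventually.of_forall fun z => by
      show DifferentiableOn ℂ (fun t : ℂ => ((s / 4 : ℝ) : ℂ) * (U₀ + t) * (z : ℂ)) (ball 0 3)
      fun_prop
  · filter_upwards [ae_restrict_mem measurableSet_Icc] with z hz t ht
    rw [mem_ball, dist_zero_right] at ht
    have hU : ‖U₀ + t‖ ≤ 4 := (norm_add_le _ _).trans (by linarith [ht.le])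
    have hz' : ‖(z : ℂ)‖ ≤ 1 := by
      rw [Complex.norm_real, Real.norm_eq_abs, abs_le]; constructor <;> linarith [hz.1, hz.2]
    rw [norm_mul, norm_mul, Complex.norm_real, Real.norm_eq_abs, abs_of_nonneg (by positivity)]
    calc s / 4 * ‖U₀ + t‖ * ‖(z : ℂ)‖ ≤ s / 4 * 4 * 1 := by gcongr
      _ = s := by ring
  · intro t _
    exact Eventually.of_forall fun z => by simp [expLin, weight]

/-- **NON-VACUITY OF THE SUPPLIER with GENUINE background dependence** (answering INFO I-3 of XREAD C-pv22g20-2): at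
`s = 1` the toy weight slice gives §L's guarded operator slice for the HONEST normalised operation `wOp (expLin ¼) … 0` on
the class `BddClass ℂ (Lebesgue⌈[0,1])`, window `[0,1]`, with the printed-shape constant `a = e³`. [folklore] -/
example : OpSliceOn (𝒰 := ℂ) (Dir := Unit) (BddClass ℂ (volume.restrict (Icc (0 : ℝ) 1)))
    (wOp (expLin (1 / 4)) (volume.restrict (Icc (0 : ℝ) 1)) 0) (Icc (0 : ℝ) 1) (fun U _ t => U + t)
    (fun _ => 1) (closedBall (0 : ℂ) 1) 1 1 (Real.exp (3 * 1)) :=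
  opSliceOn_wOp (F := ℂ) 0 (weightSlice_expLin zero_le_one) le_rfl (ae_restrict_mem measurableSet_Icc)

end Witness

/-! ## §6 Smallness is load-bearing in (1.74) [folklore] -/

section Smallness

open Complex in
/-- The two-point positive functional `w = (½, ½)` annihilates `e^{σ}` at `σ = (iπ/2, −iπ/2)`, `sup|σ| = π/2`. [folklore] -/
theorem sum_exp_eq_zero_at_pi_half :
    ∑ i : Fin 2, (1 / 2 : ℝ) • Complex.exp (![((Real.pi / 2 : ℝ) : ℂ) * I, -(((Real.pi / 2 : ℝ) : ℂ) * I)] i) = 0 := by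
  have h1 : Complex.exp (((Real.pi / 2 : ℝ) : ℂ) * I) = I := by
    rw [Complex.exp_mul_I]
    push_cast
    rw [Complex.cos_pi_div_two, Complex.sin_pi_div_two]
    simp
  rw [Fin.sum_univ_two]
  simp only [Matrix.cons_val_zero, Matrix.cons_val_one]
  rw [Complex.exp_neg, h1, Complex.inv_I, smul_neg, add_neg_cancel]

/-- `‖(π/2)·i‖ = π/2`. [folklore] -/
theorem norm_pi_half_mul_I : ‖((Real.pi / 2 : ℝ) : ℂ) * Complex.I‖ = Real.pi / 2 := by
  rw [norm_mul, Complex.norm_real, Complex.norm_I, mul_one, Real.norm_eq_abs,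
    abs_of_pos (by positivity : (0 : ℝ) < Real.pi / 2)]

/-- **SMALLNESS IS LOAD-BEARING IN (1.74).**  The statement of b02's `B16.ineq174` with the hypothesis `s ≤ 1` deleted is
FALSE: at `s = π/2` a positive functional can annihilate `e^{σ}` (`sum_exp_eq_zero_at_pi_half`), so the lower bound
`(Σw)·e^{−2s} > 0` fails.  Print states (1.74) for "σ … the small term" and derives the smallness on p. 379 (cell GAPS
C-B16-5; the V(X̃) half = the cell's OPEN G-adv3-21): a certification that the printed smallness is USED, not an objection.
[folklore] [cite: Balaban1989LargeFieldII, (1.74) p.380] -/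
theorem ineq174_needs_smallness :
    ¬ ∀ (S : Finset (Fin 2)) (w : Fin 2 → ℝ) (σ : Fin 2 → ℂ) (s : ℝ),
      (∀ i ∈ S, 0 ≤ w i) → (∀ i ∈ S, ‖σ i‖ ≤ s) →
        (∑ i ∈ S, w i) * Real.exp (-(2 * s)) ≤ ‖∑ i ∈ S, w i • Complex.exp (σ i)‖ := by
  intro h
  have h' := h Finset.univ (fun _ => 1 / 2)
    ![((Real.pi / 2 : ℝ) : ℂ) * Complex.I, -(((Real.pi / 2 : ℝ) : ℂ) * Complex.I)]
    (Real.pi / 2) (fun _ _ => by norm_num) (by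
      intro i _
      fin_cases i
      · exact norm_pi_half_mul_I.le
      · show ‖-(((Real.pi / 2 : ℝ) : ℂ) * Complex.I)‖ ≤ Real.pi / 2
        rw [norm_neg]
        exact norm_pi_half_mul_I.le)
  rw [sum_exp_eq_zero_at_pi_half, norm_zero] at h'
  have hpos : 0 < (∑ _i ∈ (Finset.univ : Finset (Fin 2)), (1 / 2 : ℝ)) * Real.exp (-(2 * (Real.pi / 2))) := by
    apply mul_pos _ (Real.exp_pos _)
    simp
  exact absurd h' (not_le.mpr hpos)

/-- CONSISTENCY — WITH the printed smallness the same two-point functional obeys b02's `B16.ineq174` (here at `s = 1`):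
the negative witness bites only beyond the printed regime. [folklore] -/
example (σ : Fin 2 → ℂ) (hσ : ∀ i ∈ (Finset.univ : Finset (Fin 2)), ‖σ i‖ ≤ 1) :
    (∑ _i ∈ (Finset.univ : Finset (Fin 2)), (1 / 2 : ℝ)) * Real.exp (-(2 * 1)) ≤
      ‖∑ i ∈ (Finset.univ : Finset (Fin 2)), (1 / 2 : ℝ) • Complex.exp (σ i)‖ :=
  B16.ineq174 Finset.univ (fun _ => 1 / 2) σ 1 (fun _ _ => by norm_num) hσ le_rfl

end Smallness

/-! ## §7 The weight slice FROM EXPONENT DATA: `ω_U = base · e^{−𝒜_U}` (v1.1) [folklore] -/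

section Exponent

variable {Z : Type*} {𝒰 : Type*}

/-- Weights of EXPONENT FORM: `ω_U(z) = base(z) · e^{−𝒜_U(z)}` — `base ≥ 0` the background-INDEPENDENT real part of
the integrand, `𝒜_U` the background-DEPENDENT part of the exponent.  [cell reading, never asserted: in (1.71) `base`
collects the (𝐔,𝐉)-independent factors of the integrand — the characteristic functions and the (𝐔,𝐉)-independent terms
of the exponential (the gauge-fixing δ-functions and the finite sum over `{Ω^c_j ∩ X, Z_j ∩ X}, r` being part of the
fluctuation measure `μ`) — and `𝒜` the quadratic form in B and the term V(X̃): p. 379 *"In the definition (1.71) only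
the quadratic form in B and the term V(X̃) depend on (𝐔,𝐉)"*.] [folklore] -/
def expWeight (base : Z → ℝ) (𝒜 : 𝒰 → Z → ℂ) (U : 𝒰) : Z → ℂ :=
  fun z => (base z : ℂ) * Complex.exp (-(𝒜 U z))

/-- Unfolding. [folklore] -/
theorem expWeight_apply (base : Z → ℝ) (𝒜 : 𝒰 → Z → ℂ) (U : 𝒰) (z : Z) :
    expWeight base 𝒜 U z = (base z : ℂ) * Complex.exp (-(𝒜 U z)) := rfl

/-- The base density of a slice: `ρ₀ = base · e^{−Re 𝒜_{U₀}}` — at a base `U₀` where `𝒜_{U₀}` is real this IS the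
integrand `ω_{U₀}` (p. 379 *"All the expressions in the definition (1.71), for the configuration U, are real, and the"*
p. 380 *"exponential density in the integral is positive"*). [folklore] -/
def baseDensity (base : Z → ℝ) (𝒜 : 𝒰 → Z → ℂ) (U₀ : 𝒰) : Z → ℝ :=
  fun z => base z * Real.exp (-(𝒜 U₀ z).re)

/-- Unfolding. [folklore] -/
theorem baseDensity_apply (base : Z → ℝ) (𝒜 : 𝒰 → Z → ℂ) (U₀ : 𝒰) (z : Z) :
    baseDensity base 𝒜 U₀ z = base z * Real.exp (-(𝒜 U₀ z).re) := rfl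

/-- The base density vanishes EXACTLY where `base` does — independently of the background `U₀` and of the exponent
`𝒜`. [folklore] -/
theorem support_baseDensity (base : Z → ℝ) (𝒜 : 𝒰 → Z → ℂ) (U₀ : 𝒰) :
    Function.support (baseDensity base 𝒜 U₀) = Function.support base := by
  ext z
  simp [baseDensity, Function.mem_support, (Real.exp_pos _).ne']

/-- THE POINTWISE FACTORISATION: where `𝒜_{U₀}(z)` is real, `ω_U(z) = ρ₀(z) · e^{σ(z)}` with `σ = 𝒜_{U₀} − 𝒜_U`
— p. 379 *"the operation 𝐓′_k(X) can be represented as the operation for a regular G-valued configuration U, with the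
additional small, and possible complex valued, term in the exponential"*; `σ` is LITERALLY the difference of the two
exponents (no normalising constant is dropped). [folklore] -/
theorem expWeight_eq_weight {base : Z → ℝ} {𝒜 : 𝒰 → Z → ℂ} {U₀ U : 𝒰} {z : Z} (hre : (𝒜 U₀ z).im = 0) :
    expWeight base 𝒜 U z = weight (baseDensity base 𝒜 U₀) (fun z => 𝒜 U₀ z - 𝒜 U z) z := by
  have hA : (((𝒜 U₀ z).re : ℝ) : ℂ) = 𝒜 U₀ z := by
    apply Complex.ext <;> simp [hre]
  rw [weight_apply, expWeight_apply, baseDensity_apply, Complex.ofReal_mul, Complex.ofReal_exp,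
    Complex.ofReal_neg, hA, mul_assoc, ← Complex.exp_add]
  congr 2
  ring

variable [MeasurableSpace Z] {Dir : Type*}

/-- `base ≥ 0` a.e. ⇒ `ρ₀ ≥ 0` a.e. — the factor `e^{−Re 𝒜_{U₀}}` is positive whatever `𝒜` and `U₀` are. [folklore] -/
theorem baseDensity_nonneg_ae {μ : Measure Z} {base : Z → ℝ} (hb : 0 ≤ᵐ[μ] base) (𝒜 : 𝒰 → Z → ℂ) (U₀ : 𝒰) :
    0 ≤ᵐ[μ] baseDensity base 𝒜 U₀ :=
  hb.mono fun _ hz => mul_nonneg hz (Real.exp_pos _).le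

/-- **POSITIVITY OF THE BASE MASS IS STRUCTURAL.**  `base ≥ 0` a.e., `ρ₀` integrable and `μ (support base) > 0` ⇒
`0 < ∫ ρ₀ dμ`, for EVERY background `U₀` and EVERY exponent `𝒜`.  Of p. 380's *"The expression 𝐓′_k(X,(U,0))1 is
obviously positive, although it may be very small"* the factor `e^{−𝒜(U,0)} > 0` is thereby AUTOMATIC; what remains —
uniformly in the background — is that the window's constraint set `{base ≠ 0}` carries fluctuation mass (cell GAPS
G-adv3-2a «L1-pos» / G-B16-16: an interior-point statement announced [Balaban1989LargeFieldI] p. 195 and not printed; a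
HYPOTHESIS here, the clause `0 < μ (support base)` of `RealBase`). [folklore] -/
theorem integral_baseDensity_pos {μ : Measure Z} {base : Z → ℝ} {𝒜 : 𝒰 → Z → ℂ} {U₀ : 𝒰}
    (hb : 0 ≤ᵐ[μ] base) (hint : Integrable (baseDensity base 𝒜 U₀) μ)
    (hpos : 0 < μ (Function.support base)) :
    0 < ∫ z, baseDensity base 𝒜 U₀ z ∂μ := by
  rw [integral_pos_iff_support_of_nonneg_ae (baseDensity_nonneg_ae hb 𝒜 U₀) hint, support_baseDensity]
  exact hpos

/-- HYPOTHESIS SHAPE — **THE EXPONENT SLICE** (printed TYPE, NOT asserted): for every regular base `U₀ ∈ 𝒦` and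
admissible direction `d` (`0 < N d ≤ w`) an OPEN `Ω ⊆ ℂ` containing the closed discs of radius `ϱ / N d` about `[0,1]`
on which, along the slice `t ↦ move U₀ d t`, the exponent `𝒜` is a.e.-strongly measurable in the fluctuation
variables, HOLOMORPHIC in `t` for a.e. `z`, and of OSCILLATION at most `s` about the base value:
`‖𝒜_{move U₀ d t}(z) − 𝒜_{U₀}(z)‖ ≤ s` for `t ∈ Ω`, a.e. `z`.  [cell reading, never asserted: holomorphy is (1.65)
p. 375 / [IV] (1.89) restricted to the slice; the oscillation bound is p. 379 *"We expand them up to the first order in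
𝐀′,𝐉, the first order terms are already small"* — σ_Q cell GAPS C-B16-5, σ_V the cell's OPEN G-adv3-21.] [folklore] -/
def ExponentSlice (𝒜 : 𝒰 → Z → ℂ) (μ : Measure Z) (move : 𝒰 → Dir → ℂ → 𝒰) (N : Dir → ℝ) (𝒦 : Set 𝒰)
    (w ϱ s : ℝ) : Prop :=
  ∀ U₀ ∈ 𝒦, ∀ d : Dir, 0 < N d → N d ≤ w →
    ∃ Ω : Set ℂ, IsOpen Ω ∧ (∀ x ∈ Icc (0 : ℝ) 1, closedBall (x : ℂ) (ϱ / N d) ⊆ Ω) ∧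
      (∀ t ∈ Ω, AEStronglyMeasurable (𝒜 (move U₀ d t)) μ) ∧
      (∀ᵐ z ∂μ, DifferentiableOn ℂ (fun t => 𝒜 (move U₀ d t) z) Ω) ∧
      (∀ᵐ z ∂μ, ∀ t ∈ Ω, ‖𝒜 (move U₀ d t) z - 𝒜 U₀ z‖ ≤ s)

/-- HYPOTHESIS SHAPE — **THE REAL REGULAR BASE** (printed TYPE + ONE not-printed interior-point clause; NOT asserted):
`base ≥ 0` a.e. with `μ (support base) > 0` (the window's constraint set carries fluctuation mass — G-adv3-2a / G-B16-16),
and at every regular base `U₀ ∈ 𝒦`: `𝒜_{U₀}` a.e.-strongly measurable and REAL a.e. (p. 379), and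
`ρ₀ = base · e^{−Re 𝒜_{U₀}}` integrable (the unnormalised operation at (U,0) is a finite integral). [folklore] -/
def RealBase (base : Z → ℝ) (𝒜 : 𝒰 → Z → ℂ) (μ : Measure Z) (𝒦 : Set 𝒰) : Prop :=
  0 ≤ᵐ[μ] base ∧ 0 < μ (Function.support base) ∧
    ∀ U₀ ∈ 𝒦, AEStronglyMeasurable (𝒜 U₀) μ ∧ (∀ᵐ z ∂μ, (𝒜 U₀ z).im = 0) ∧
      Integrable (baseDensity base 𝒜 U₀) μ

variable {base : Z → ℝ} {𝒜 : 𝒰 → Z → ℂ} {μ : Measure Z} {move : 𝒰 → Dir → ℂ → 𝒰} {N : Dir → ℝ}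
  {𝒦 : Set 𝒰} {w ϱ s : ℝ}

/-- **THE CONSTRUCTOR — §3's `WeightSlice` FROM EXPONENT DATA.**  A real regular base and an exponent slice of
oscillation `s` give the weight slice for the exponent-form weights `expWeight base 𝒜`, with
`ρ₀ = base · e^{−Re 𝒜_{U₀}}` (`t`-INDEPENDENT, `≥ 0` a.e., integrable, of positive mass by `integral_baseDensity_pos`)
and `σ_t = 𝒜_{U₀} − 𝒜_{move U₀ d t}` (a.e.-measurable, holomorphic in `t`, `‖σ_t‖ ≤ s`), the factorisation
`ω_{move U₀ d t} = ρ₀ · e^{σ_t}` holding a.e. by `expWeight_eq_weight`.  The §3 binder's three analytic clauses are thus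
read off THE EXPONENT — where the printed sentences live — and its positivity clause off the constraint set alone. [folklore] -/
theorem weightSlice_of_exponentSlice (hB : RealBase base 𝒜 μ 𝒦) (hE : ExponentSlice 𝒜 μ move N 𝒦 w ϱ s) :
    WeightSlice (expWeight base 𝒜) μ move N 𝒦 w ϱ s := by
  intro U₀ hU₀ d hd hdw
  obtain ⟨Ω, hΩ, hballs, hAm, hAd, hAb⟩ := hE U₀ hU₀ d hd hdw
  obtain ⟨hb, hpos, hB'⟩ := hB
  obtain ⟨hm0, hre, hint⟩ := hB' U₀ hU₀
  refine ⟨Ω, hΩ, hballs, baseDensity base 𝒜 U₀, baseDensity_nonneg_ae hb 𝒜 U₀, hint,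
    integral_baseDensity_pos hb hint hpos, fun t z => 𝒜 U₀ z - 𝒜 (move U₀ d t) z,
    fun t ht => hm0.sub (hAm t ht), ?_, ?_, ?_⟩
  · filter_upwards [hAd] with z hz
    exact (differentiableOn_const _).sub hz
  · filter_upwards [hAb] with z hz t ht
    rw [norm_sub_rev]
    exact hz t ht
  · intro t _
    filter_upwards [hre] with z hz
    exact expWeight_eq_weight hz

variable {F : Type*} [NormedAddCommGroup F] [NormedSpace ℂ F]

/-- **THE SUPPLIER IN EXPONENT CURRENCY**: real regular base + exponent slice with `s ≤ 1` + a window `D` of full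
measure ⇒ §L's `OpSliceOn (BddClass F μ) (wOp (expWeight base 𝒜) μ z₀) D move N 𝒦 w ϱ (e^{3s})` — §3's
`opSliceOn_wOp` composed with the constructor; the constant is still the PRINTED (1.75) constant `e^{3 sup|σ|}`, with
`sup|σ|` now the oscillation of the exponent along the slice. [folklore] -/
theorem opSliceOn_wOp_exp {D : Set Z} (z₀ : Z) (hB : RealBase base 𝒜 μ 𝒦)
    (hE : ExponentSlice 𝒜 μ move N 𝒦 w ϱ s) (hs : s ≤ 1) (hD : ∀ᵐ z ∂μ, z ∈ D) :
    OpSliceOn (BddClass F μ) (wOp (expWeight base 𝒜) μ z₀) D move N 𝒦 w ϱ (Real.exp (3 * s)) :=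
  opSliceOn_wOp z₀ (weightSlice_of_exponentSlice hB hE) hs hD

end Exponent

section ConsumptionLatticeExp

open T4BirthChartTransport (GaugeInvariant BirthSlice RelGauge)
open T4BlockTransport (Fld NDir latMove latN)

variable {B : Booking} {T : Trajectory B}
variable {R : Type*} [NormedRing R] [NormedAlgebra ℂ R] [MeasurableSpace R] {d : ℕ}
  {F : Type*} [NormedAddCommGroup F] [NormedSpace ℂ F] [CompleteSpace F]

/-- **THE DRESSED PIPELINE ON `ℤ^d` FED BY EXPONENT DATA** — §4's `transportsFromVar_of_weightSlices_lattice` VERBATIM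
except that, per met step `k`, the weights ARE of exponent form `expWeight (base k) (𝒜 k)` and the weight-slice binder
`hws` is REPLACED by a real regular base `hB` on the thin current-scale window `𝒦 b k' (k+1)` and an exponent slice `hE`
of oscillation `s k ≤ 1` along the lattice chart; `a k = e^{3 s_k}`, domination `e^{3 s_k}·(1 + 4θ_k/ϱ) ≤ α k`.  SAME
conclusion `T.TransportsFromVar (4c_δ/r) (fun i => ψ·α i) Gate`. [folklore] -/
theorem transportsFromVar_of_exponentSlices_lattice {Gate : ℕ → Prop} {Fn : B.Birth → ℕ → ℕ → Fld d R → F}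
    {rel : B.Birth → ℕ → ℕ → Fld d R → Fld d R → Prop} {𝒦 : B.Birth → ℕ → ℕ → Set (Fld d R)}
    {base : ℕ → Fld d R → ℝ} {𝒜 : ℕ → Fld d R → Fld d R → ℂ}
    {μ : ℕ → Measure (Fld d R)} {z₀ : ℕ → Fld d R} {D : ℕ → Set (Fld d R)}
    {defect : B.Birth → ℕ → ℕ → ℝ} {cδ ψ w r : ℝ} {s α θ : ℕ → ℝ} {ϱ : B.Birth → ℕ → ℕ → ℝ}
    (hα : ∀ i, 0 ≤ α i) (hr : 0 < r) (hw : 0 < w)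
    (hsl : ∀ (b : B.Birth) (k' : ℕ), B.birthScale b ≤ k' → k' ≤ B.K → RanBelow Gate k' →
      BirthSlice (Fn b k' k') latMove latN (𝒦 b k' k') w r (T.gen b k'))
    (hFn : ∀ (b : B.Birth) (k' k : ℕ), B.birthScale b ≤ k' → k' ≤ k → k + 1 ≤ B.K → RanBelow Gate (k + 1) →
      ∀ U, Fn b k' (k + 1) U = wOp (expWeight (base k) (𝒜 k)) (μ k) (z₀ k) U (fun z => Fn b k' k (U + z)))
    (h𝒢 : ∀ (b : B.Birth) (k' k : ℕ), B.birthScale b ≤ k' → k' ≤ k → k + 1 ≤ B.K → RanBelow Gate (k + 1) →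
      ∀ U, (fun z => Fn b k' k (U + z)) ∈ BddClass F (μ k))
    (hD : ∀ k, (D k).Nonempty) (hϱ : ∀ b k' k, 0 < ϱ b k' k)
    (hB : ∀ (b : B.Birth) (k' k : ℕ), B.birthScale b ≤ k' → k' ≤ k → k + 1 ≤ B.K → RanBelow Gate (k + 1) →
      RealBase (base k) (𝒜 k) (μ k) (𝒦 b k' (k + 1)))
    (hE : ∀ (b : B.Birth) (k' k : ℕ), B.birthScale b ≤ k' → k' ≤ k → k + 1 ≤ B.K → RanBelow Gate (k + 1) →
      ExponentSlice (𝒜 k) (μ k) latMove latN (𝒦 b k' (k + 1)) w (ϱ b k' k) (s k))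
    (hs : ∀ k, s k ≤ 1) (hDμ : ∀ k, ∀ᵐ z ∂μ k, z ∈ D k)
    (hN1 : ∀ (b : B.Birth) (k' k : ℕ), B.birthScale b ≤ k' → k' ≤ k → k + 1 ≤ B.K →
      ∀ z ∈ D k, ∀ U ∈ 𝒦 b k' (k + 1), U + z ∈ 𝒦 b k' k)
    (hN2 : ∀ (b : B.Birth) (k' k : ℕ), B.birthScale b ≤ k' → k' ≤ k → k + 1 ≤ B.K →
      ∀ U₀ ∈ 𝒦 b k' (k + 1), ∀ p : NDir d R, latN p ≤ w → ∀ z' ∈ D k, latMove U₀ p 1 + z' ∈ 𝒦 b k' k)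
    (hdiam : ∀ k, ∀ z ∈ D k, ∀ z' ∈ D k, ∀ x ν, ‖z x ν - z' x ν‖ ≤ θ k)
    (hθ : ∀ k, 0 < θ k ∧ θ k ≤ w)
    (hdom : ∀ (b : B.Birth) (k' k : ℕ), B.birthScale b ≤ k' → k' ≤ k → k + 1 ≤ B.K →
      Real.exp (3 * s k) * (1 + 4 * θ k / ϱ b k' k) ≤ α k)
    (hinv : ∀ b k' k, GaugeInvariant (rel b k' k) (Fn b k' k))
    (hdefw : ∀ b k' k, defect b k' k ≤ w)
    (hrate : ∀ (b : B.Birth) (k' k : ℕ), B.birthScale b ≤ k' → k' ≤ k → k ≤ B.K →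
      defect b k' k ≤ cδ * ψ ^ (k - k'))
    (hlin : ∀ (b : B.Birth) (k' k : ℕ), B.birthScale b ≤ k' → k' ≤ k → k ≤ B.K → RanBelow Gate k → ∀ ε > 0,
      ∃ U₀ ∈ 𝒦 b k' k, ∃ U₁ : Fld d R, RelGauge (rel b k' k) latMove latN U₀ U₁ (defect b k' k) ∧
        T.lin b k' k ≤ ‖Fn b k' k U₁ - Fn b k' k U₀‖ + ε) :
    T.TransportsFromVar (4 * cδ / r) (fun i => ψ * α i) Gate :=
  transportsFromVar_of_weightSlices_lattice (ω := fun k => expWeight (base k) (𝒜 k)) hα hr hw hsl hFn h𝒢 hD hϱ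
    (fun b k' k hbk' hk'k hk hran =>
      weightSlice_of_exponentSlice (hB b k' k hbk' hk'k hk hran) (hE b k' k hbk' hk'k hk hran))
    hs hDμ hN1 hN2 hdiam hθ hdom hinv hdefw hrate hlin

end ConsumptionLatticeExp

/-! ## §8 Non-vacuity of the exponent currency, with a REAL base set and genuine background dependence (toy) -/

section WitnessExp

/-- The toy exponents `𝒜_U(z) = −c·U·z` on `[0,1]`: `expWeight 1 (linExp c) = expLin c` (§5's weights). [folklore] -/
def linExp (c : ℝ) (U : ℂ) (z : ℝ) : ℂ := -(((c : ℝ) : ℂ) * U * (z : ℂ))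

/-- Consistency with §5: the exponent-form weights with `base = 1`, `𝒜 = linExp c` ARE `expLin c`. [folklore] -/
theorem expWeight_one_linExp (c : ℝ) : expWeight (fun _ : ℝ => (1 : ℝ)) (linExp c) = expLin c := by
  funext U z
  simp [expWeight, linExp, expLin]

/-- The REAL regular bases of the toy: real points of the closed unit disc. [folklore] -/
def realBall : Set ℂ := {U : ℂ | U.im = 0 ∧ ‖U‖ ≤ 1}

/-- **`RealBase` IS MET by the toy**: `base = 1 ≥ 0`, `Lebesgue⌈[0,1] (support 1) = 1 > 0`; at a real `U₀` the exponent
`−c·U₀·z` is continuous (hence a.e.-strongly measurable) and REAL, and `e^{−Re 𝒜_{U₀}}` is continuous on `[0,1]`, hence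
integrable. [folklore] -/
theorem realBase_linExp (c : ℝ) :
    RealBase (fun _ : ℝ => (1 : ℝ)) (linExp c) (volume.restrict (Icc (0 : ℝ) 1)) realBall := by
  refine ⟨Eventually.of_forall fun _ => zero_le_one, ?_, fun U₀ hU₀ => ⟨?_, ?_, ?_⟩⟩
  · rw [Function.support_const one_ne_zero, Measure.restrict_apply_univ, Real.volume_Icc]
    norm_num
  · exact Continuous.aestronglyMeasurable (by unfold linExp; fun_prop)
  · exact Eventually.of_forall fun z => by
      simp [linExp, Complex.mul_im, Complex.mul_re, hU₀.1]
  · show IntegrableOn _ _ _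
    exact Continuous.integrableOn_Icc (by unfold baseDensity linExp; fun_prop)

/-- **`ExponentSlice` IS MET by the toy** with `move U _ t = U + t`, unit window norm, `w = ϱ = 1`, oscillation `s`
for `c = s/3`, every `s ≥ 0`: `Ω = ball 0 3` (contains the unit discs about `[0,1]`), holomorphy of
`t ↦ −c·(U₀ + t)·z`, and `‖𝒜_{U₀+t}(z) − 𝒜_{U₀}(z)‖ = c·|t|·|z| ≤ (s/3)·3·1` on `Ω × [0,1]`. [folklore] -/
theorem exponentSlice_linExp {s : ℝ} (hs : 0 ≤ s) :
    ExponentSlice (Dir := Unit) (linExp (s / 3)) (volume.restrict (Icc (0 : ℝ) 1)) (fun U _ t => U + t)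
      (fun _ => 1) realBall 1 1 s := by
  intro U₀ _ d _ _
  refine ⟨ball 0 3, isOpen_ball, ?_, ?_, ?_, ?_⟩
  · intro x hx t ht
    rw [mem_closedBall, dist_eq_norm] at ht
    rw [mem_ball, dist_zero_right]
    have hx' : ‖(x : ℂ)‖ ≤ 1 := by
      rw [Complex.norm_real, Real.norm_eq_abs, abs_le]; constructor <;> linarith [hx.1, hx.2]
    calc ‖t‖ = ‖(t - x) + x‖ := by rw [sub_add_cancel]
      _ ≤ ‖t - (x : ℂ)‖ + ‖(x : ℂ)‖ := norm_add_le _ _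
      _ ≤ 1 / 1 + 1 := add_le_add ht hx'
      _ < 3 := by norm_num
  · intro t _
    exact Continuous.aestronglyMeasurable (by unfold linExp; fun_prop)
  · exact Eventually.of_forall fun z => by
      show DifferentiableOn ℂ (fun t : ℂ => linExp (s / 3) (U₀ + t) z) (ball 0 3)
      unfold linExp
      fun_prop
  · filter_upwards [ae_restrict_mem measurableSet_Icc] with z hz t ht
    rw [mem_ball, dist_zero_right] at ht
    have hz' : ‖(z : ℂ)‖ ≤ 1 := by
      rw [Complex.norm_real, Real.norm_eq_abs, abs_le]; constructor <;> linarith [hz.1, hz.2]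
    have hdiff : linExp (s / 3) (U₀ + t) z - linExp (s / 3) U₀ z = -((((s / 3 : ℝ)) : ℂ) * t * (z : ℂ)) := by
      unfold linExp; ring
    rw [hdiff, norm_neg, norm_mul, norm_mul, Complex.norm_real, Real.norm_eq_abs,
      abs_of_nonneg (by positivity)]
    calc s / 3 * ‖t‖ * ‖(z : ℂ)‖ ≤ s / 3 * 3 * 1 := by gcongr
      _ = s := by ring

/-- **NON-VACUITY OF THE CONSTRUCTOR**: the toy's exponent data give §3's weight slice for the weights `expLin (s/3)`
over the REAL base set, every `s ≥ 0`. [folklore] -/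
theorem weightSlice_linExp {s : ℝ} (hs : 0 ≤ s) :
    WeightSlice (Dir := Unit) (expWeight (fun _ : ℝ => (1 : ℝ)) (linExp (s / 3)))
      (volume.restrict (Icc (0 : ℝ) 1)) (fun U _ t => U + t) (fun _ => 1) realBall 1 1 s :=
  weightSlice_of_exponentSlice (realBase_linExp (s / 3)) (exponentSlice_linExp hs)

/-- … hence, at `s = 1`, §L's guarded operator slice for the HONEST normalised operation with the printed-shape constant
`a = e³`, now fed by EXPONENT data (compare §5's `example`, fed by a weight slice written by hand). [folklore] -/
example : OpSliceOn (𝒰 := ℂ) (Dir := Unit) (BddClass ℂ (volume.restrict (Icc (0 : ℝ) 1)))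
    (wOp (expWeight (fun _ : ℝ => (1 : ℝ)) (linExp (1 / 3))) (volume.restrict (Icc (0 : ℝ) 1)) 0) (Icc (0 : ℝ) 1)
    (fun U _ t => U + t) (fun _ => 1) realBall 1 1 (Real.exp (3 * 1)) :=
  opSliceOn_wOp_exp (F := ℂ) 0 (realBase_linExp (1 / 3)) (exponentSlice_linExp zero_le_one) le_rfl
    (ae_restrict_mem measurableSet_Icc)

end WitnessExp

/-! ## §9 Holomorphic and real-valued ⇒ constant: the v1.1 exponent currency DEGENERATES on complex-open windows [folklore] -/

section RealHolomorphic

open _root_.Topology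

/-- Holomorphic near `t₀` and REAL-valued near `t₀` ⇒ eventually constant near `t₀` (open mapping theorem: a
non-constant holomorphic germ maps neighbourhoods onto neighbourhoods, and the real line contains no disc). [folklore] -/
theorem eventually_const_of_im_eq_zero {g : ℂ → ℂ} {t₀ : ℂ} (hg : AnalyticAt ℂ g t₀)
    (hre : ∀ᶠ t in 𝓝 t₀, (g t).im = 0) : ∀ᶠ t in 𝓝 t₀, g t = g t₀ := by
  rcases hg.eventually_constant_or_nhds_le_map_nhds with h | h
  · exact h
  · exfalso
    have h1 : {w : ℂ | w.im = 0} ∈ map g (𝓝 t₀) := hre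
    have h2 : {w : ℂ | w.im = 0} ∈ 𝓝 (g t₀) := h h1
    rcases Metric.mem_nhds_iff.mp h2 with ⟨ε, hε, hball⟩
    have hmem : g t₀ + (ε / 2 : ℝ) * Complex.I ∈ ball (g t₀) ε := by
      rw [mem_ball, dist_eq_norm]
      simp [Complex.norm_I, abs_of_pos hε]
      linarith
    have := hball hmem
    simp at this
    have h0 : (g t₀).im = 0 := by
      have := hball (mem_ball_self hε)
      simpa using this
    simp [h0] at this
    exact absurd this hε.ne'

/-- Holomorphic on an open `Ω`, real-valued near a point `t₀` of an open preconnected `W ⊆ Ω` ⇒ constant on `W`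
(identity theorem). [folklore] -/
theorem eqOn_const_of_im_eq_zero {g : ℂ → ℂ} {Ω W : Set ℂ} {t₀ : ℂ} (hd : DifferentiableOn ℂ g Ω)
    (hW : IsOpen W) (hWc : IsPreconnected W) (hWΩ : W ⊆ Ω) (ht₀ : t₀ ∈ W)
    (hre : ∀ᶠ t in 𝓝 t₀, (g t).im = 0) : ∀ t ∈ W, g t = g t₀ := by
  have hA : AnalyticOnNhd ℂ g W := (hd.mono hWΩ).analyticOnNhd hW
  have h := hA.eqOn_of_preconnected_of_eventuallyEq analyticOnNhd_const hWc ht₀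
    (eventually_const_of_im_eq_zero (hA t₀ ht₀) hre)
  exact fun t ht => h ht

/-- Continuous on an open `V` and real-valued on a subset `S` with `V ⊆ closure (V ∩ S)` ⇒ real-valued on `V`. [folklore] -/
theorem im_eq_zero_of_dense {g : ℂ → ℂ} {V S : Set ℂ} (hg : ContinuousOn g V) (hV : IsOpen V)
    (hS : V ⊆ closure (V ∩ S)) (h0 : ∀ t ∈ V ∩ S, (g t).im = 0) : ∀ t ∈ V, (g t).im = 0 := by
  intro t ht
  have hc : ContinuousWithinAt (fun t => (g t).im) (V ∩ S) t :=
    (Complex.continuous_im.continuousAt.comp (hg.continuousAt (hV.mem_nhds ht))).continuousWithinAt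
  have hmem := hc.mem_closure_image (hS ht)
  have hsub : (fun t => (g t).im) '' (V ∩ S) ⊆ {0} := by
    rintro _ ⟨u, hu, rfl⟩
    exact h0 u hu
  have h := closure_mono hsub hmem
  rwa [closure_singleton, mem_singleton_iff] at h

/-- The open tube of radius `ρ` about the segment `[0,1] ⊆ ℂ`. [folklore] -/
def tube (ρ : ℝ) : Set ℂ := thickening ρ (segment ℝ (0 : ℂ) 1)

/-- The tube is open. [folklore] -/
theorem isOpen_tube (ρ : ℝ) : IsOpen (tube ρ) := isOpen_thickening

/-- The tube is preconnected (it is convex). [folklore] -/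
theorem isPreconnected_tube (ρ : ℝ) : IsPreconnected (tube ρ) :=
  ((convex_segment (0 : ℂ) 1).thickening ρ).isPreconnected

/-- The tube contains `[0,1]`. [folklore] -/
theorem ofReal_mem_tube {ρ : ℝ} (hρ : 0 < ρ) {x : ℝ} (hx : x ∈ Icc (0 : ℝ) 1) : (x : ℂ) ∈ tube ρ := by
  refine self_subset_thickening hρ _ ?_
  rw [segment_eq_image]
  exact ⟨x, hx, by simp⟩

/-- The tube lies inside every set containing the closed discs of radius `ρ` about `[0,1]` — the `Ω` of a slice. [folklore] -/
theorem tube_subset {ρ : ℝ} {Ω : Set ℂ} (hΩ : ∀ x ∈ Icc (0 : ℝ) 1, closedBall (x : ℂ) ρ ⊆ Ω) : tube ρ ⊆ Ω := by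
  intro t ht
  obtain ⟨y, hy, hty⟩ := mem_thickening_iff.mp ht
  rw [segment_eq_image] at hy
  obtain ⟨x, hx, rfl⟩ := hy
  have h : (fun θ : ℝ => (1 - θ) • (0 : ℂ) + θ • (1 : ℂ)) x = (x : ℂ) := by simp
  rw [h] at hty
  exact hΩ x hx (mem_closedBall.mpr hty.le)

variable {Z : Type*} [MeasurableSpace Z] {𝒰 Dir : Type*}

/-- **DEGENERACY OF THE v1.1 EXPONENT CURRENCY AT INTERIOR POINTS.**  If the exponent is REAL a.e. at EVERY point of
the window `𝒦` (the reality clause of `RealBase`), obeys an `ExponentSlice` on `𝒦` (holomorphy in `t` on an open `Ω`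
containing the discs of radius `ϱ / N q` about `[0,1]`), and the slice from `U₀ ∈ 𝒦` in the admissible direction `q`
STAYS IN `𝒦` for all complex `t` of modulus `< δ` (an interior point in the direction `q`), then for a.e. `z` the
exponent is CONSTANT along the slice on the whole tube of radius `ϱ / N q` about `[0,1]`: holomorphic + real-valued on
the disc `‖t‖ < min δ (ϱ/N q)` (reality transported from countably many slice points by continuity) ⇒ constant there
(open mapping theorem) ⇒ constant on the tube (identity theorem).  So `σ_t = 𝒜_{U₀} − 𝒜_{move U₀ q t} = 0` there:
the weights built by `weightSlice_of_exponentSlice` carry NO background dependence along such slices. [folklore] -/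
theorem exponent_const_on_tube {𝒜 : 𝒰 → Z → ℂ} {μ : Measure Z} {move : 𝒰 → Dir → ℂ → 𝒰} {N : Dir → ℝ}
    {𝒦 : Set 𝒰} {w ϱ s : ℝ} (hre : ∀ U ∈ 𝒦, ∀ᵐ z ∂μ, (𝒜 U z).im = 0)
    (hE : ExponentSlice 𝒜 μ move N 𝒦 w ϱ s) (hϱ : 0 < ϱ) {U₀ : 𝒰} (hU₀ : U₀ ∈ 𝒦) {q : Dir}
    (hq : 0 < N q) (hqw : N q ≤ w) {δ : ℝ} (hδ : 0 < δ) (hin : ∀ t : ℂ, ‖t‖ < δ → move U₀ q t ∈ 𝒦) :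
    ∀ᵐ z ∂μ, ∀ t ∈ tube (ϱ / N q), 𝒜 (move U₀ q t) z = 𝒜 (move U₀ q 0) z := by
  obtain ⟨Ω, hΩ, hballs, -, hAd, -⟩ := hE U₀ hU₀ q hq hqw
  set ε := min δ (ϱ / N q) with hε_def
  have hε : 0 < ε := lt_min hδ (div_pos hϱ hq)
  have hBΩ : ball (0 : ℂ) ε ⊆ Ω := by
    intro t ht
    rw [mem_ball, dist_zero_right] at ht
    have h0 := hballs 0 (left_mem_Icc.mpr zero_le_one)
    apply h0
    rw [mem_closedBall, Complex.ofReal_zero, dist_zero_right]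
    exact (ht.trans_le (min_le_right _ _)).le
  have hB𝒦 : ∀ t ∈ ball (0 : ℂ) ε, move U₀ q t ∈ 𝒦 := fun t ht => by
    rw [mem_ball, dist_zero_right] at ht
    exact hin t (ht.trans_le (min_le_left _ _))
  obtain ⟨S, hSc, hSd⟩ := TopologicalSpace.exists_countable_dense ℂ
  have hcount : (ball (0 : ℂ) ε ∩ S).Countable := hSc.mono inter_subset_right
  have hreal : ∀ᵐ z ∂μ, ∀ t ∈ ball (0 : ℂ) ε ∩ S, (𝒜 (move U₀ q t) z).im = 0 :=
    (ae_ball_iff hcount).mpr fun t ht => hre _ (hB𝒦 t ht.1)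
  filter_upwards [hAd, hreal] with z hd hr
  have him : ∀ t ∈ ball (0 : ℂ) ε, (𝒜 (move U₀ q t) z).im = 0 :=
    im_eq_zero_of_dense (hd.continuousOn.mono hBΩ) isOpen_ball (hSd.open_subset_closure_inter isOpen_ball) hr
  have hev : ∀ᶠ t in 𝓝 (0 : ℂ), (𝒜 (move U₀ q t) z).im = 0 :=
    eventually_of_mem (isOpen_ball.mem_nhds (mem_ball_self hε)) him
  have h0 : (0 : ℂ) ∈ tube (ϱ / N q) := by
    simpa using ofReal_mem_tube (div_pos hϱ hq) (left_mem_Icc.mpr (zero_le_one (α := ℝ)))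
  exact eqOn_const_of_im_eq_zero hd (isOpen_tube _) (isPreconnected_tube _) (tube_subset hballs) h0 hev

/-- … in particular under `RealBase` (whose third clause IS reality a.e. at every point of `𝒦`). [folklore] -/
theorem exponent_const_on_tube_of_realBase {base : Z → ℝ} {𝒜 : 𝒰 → Z → ℂ} {μ : Measure Z}
    {move : 𝒰 → Dir → ℂ → 𝒰} {N : Dir → ℝ} {𝒦 : Set 𝒰} {w ϱ s : ℝ} (hB : RealBase base 𝒜 μ 𝒦)
    (hE : ExponentSlice 𝒜 μ move N 𝒦 w ϱ s) (hϱ : 0 < ϱ) {U₀ : 𝒰} (hU₀ : U₀ ∈ 𝒦) {q : Dir}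
    (hq : 0 < N q) (hqw : N q ≤ w) {δ : ℝ} (hδ : 0 < δ) (hin : ∀ t : ℂ, ‖t‖ < δ → move U₀ q t ∈ 𝒦) :
    ∀ᵐ z ∂μ, ∀ t ∈ tube (ϱ / N q), 𝒜 (move U₀ q t) z = 𝒜 (move U₀ q 0) z :=
  exponent_const_on_tube (fun U hU => (hB.2.2 U hU).2.1) hE hϱ hU₀ hq hqw hδ hin

variable {F : Type*} [NormedAddCommGroup F] [NormedSpace ℂ F]

/-- `wOp` sees the background only through the a.e.-class of the weight. [folklore] -/
theorem wOp_congr_ae {ω : 𝒰 → Z → ℂ} {μ : Measure Z} (z₀ : Z) {U U' : 𝒰} (h : ω U =ᵐ[μ] ω U') (g : Z → F) :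
    wOp ω μ z₀ U g = wOp ω μ z₀ U' g := by
  have hi : Integrable (ω U) μ ↔ Integrable (ω U') μ := ⟨fun hI => hI.congr h, fun hI => hI.congr h.symm⟩
  have hI : ∫ z, ω U z ∂μ = ∫ z, ω U' z ∂μ := integral_congr_ae h
  have hIg : ∫ z, ω U z • g z ∂μ = ∫ z, ω U' z • g z ∂μ :=
    integral_congr_ae (h.mono fun z hz => by simp only [hz])
  by_cases hc : Integrable (ω U') μ ∧ (∫ z, ω U' z ∂μ) ≠ 0
  · rw [wOp_of_pos hc.1 hc.2, wOp_of_pos (hc.1.congr h.symm) (by rw [hI]; exact hc.2), hI, hIg]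
  · rw [wOp_of_neg hc, wOp_of_neg (by rwa [hi, hI])]

end RealHolomorphic

section LatticeDegeneracy

open T4BlockTransport (Fld NDir latMove latN norm_dir_le latMove_zero)

variable {R : Type*} [NormedRing R] {d : ℕ}

/-- The zero direction with declared bound `0`. [folklore] -/
def zeroDir : NDir d R := ⟨(0, 0), fun x ν => by simp⟩

/-- Its declared bound. [folklore] -/
@[simp] theorem latN_zeroDir : latN (zeroDir : NDir d R) = 0 := rfl

/-- A bond field of sup-norm `≤ w` as a declared direction with declared bound `w`. [folklore] -/
def fldDir (f : Fld d R) (w : ℝ) (hf : ∀ x ν, ‖f x ν‖ ≤ w) : NDir d R := ⟨(f, w), hf⟩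

/-- Its declared bound. [folklore] -/
@[simp] theorem latN_fldDir (f : Fld d R) (w : ℝ) (hf : ∀ x ν, ‖f x ν‖ ≤ w) : latN (fldDir f w hf) = w := rfl

variable [NormedAlgebra ℂ R]

/-- A declared direction scaled by a complex number (declared bound scaled by its modulus) — admissible directions are
closed under COMPLEX scaling because `R` is a `ℂ`-algebra and `NDir` constrains norms only. [folklore] -/
def smulDir (t : ℂ) (p : NDir d R) : NDir d R :=
  ⟨(t • p.1.1, ‖t‖ * latN p), fun x ν => by
    show ‖(t • p.1.1) x ν‖ ≤ ‖t‖ * latN p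
    simp only [Pi.smul_apply, norm_smul]
    exact mul_le_mul_of_nonneg_left (norm_dir_le p x ν) (norm_nonneg _)⟩

/-- Its declared bound. [folklore] -/
@[simp] theorem latN_smulDir (t : ℂ) (p : NDir d R) : latN (smulDir t p) = ‖t‖ * latN p := rfl

/-- Moving by `1` along the scaled direction is moving by `t` along the direction. [folklore] -/
theorem latMove_smulDir (U : Fld d R) (p : NDir d R) (t : ℂ) : latMove U (smulDir t p) 1 = latMove U p t := by
  funext x ν
  simp [latMove, smulDir]

/-- Moving along the zero direction does nothing. [folklore] -/
@[simp] theorem latMove_zeroDir (U : Fld d R) (t : ℂ) : latMove U zeroDir t = U := by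
  funext x ν
  simp [latMove, zeroDir]

/-- Moving by `1` along `fldDir f` is adding `f`. [folklore] -/
theorem latMove_fldDir_one (U f : Fld d R) (w : ℝ) (hf : ∀ x ν, ‖f x ν‖ ≤ w) :
    latMove U (fldDir f w hf) 1 = U + f := by
  funext x ν
  simp [latMove, fldDir]

/-- The chart commutes with translation by the fluctuation variable. [folklore] -/
theorem latMove_add_right (U z : Fld d R) (p : NDir d R) (t : ℂ) : latMove (U + z) p t = latMove U p t + z := by
  funext x ν
  simp only [latMove, Pi.add_apply]
  exact add_right_comm _ _ _

variable [MeasurableSpace R]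

/-- **DEGENERACY ON `ℤ^d` — THE v1.1 BINDERS `hB`, `hE` AT STEP `k` AND `hN2` AT STEP `k+1` FORCE A BACKGROUND-INDEPENDENT
EXPONENT.**  Windows `𝒦₁` (scale `k+1`) and `𝒦₂` (scale `k+2`), fluctuation window `D₁` (step `k+1`): a real regular
base and an exponent slice on `𝒦₁` along the lattice chart with window norm `w > 0` and `ϱ > 0`, and the nesting (N2)
one level up — `latMove V p 1 + z' ∈ 𝒦₁` for `V ∈ 𝒦₂`, EVERY declared direction with `latN p ≤ w` (complex multiples
included: `R` is a `ℂ`-algebra) and `z' ∈ D₁` — give, at every point `V + z'`, along every admissible direction `p`: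
for a.e. `z`, `𝒜 (latMove (V + z') p t) z = 𝒜 (V + z') z` on the whole tube of radius `ϱ / latN p` about `[0,1]`
(`exponent_const_on_tube`: the slice stays in `𝒦₁` for `‖t‖ < 1` since `latMove (V + z') p t = latMove V (t·p) 1 + z'`). [folklore] -/
theorem exponent_const_on_tube_lattice {𝒦₁ 𝒦₂ D₁ : Set (Fld d R)} {base : Fld d R → ℝ}
    {𝒜 : Fld d R → Fld d R → ℂ} {μ : Measure (Fld d R)} {w ϱ s : ℝ} (hw : 0 < w) (hϱ : 0 < ϱ)
    (hB : RealBase base 𝒜 μ 𝒦₁) (hE : ExponentSlice 𝒜 μ latMove latN 𝒦₁ w ϱ s)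
    (hN2 : ∀ U₀ ∈ 𝒦₂, ∀ p : NDir d R, latN p ≤ w → ∀ z' ∈ D₁, latMove U₀ p 1 + z' ∈ 𝒦₁)
    {V : Fld d R} (hV : V ∈ 𝒦₂) {z' : Fld d R} (hz' : z' ∈ D₁) {p : NDir d R} (hp : 0 < latN p)
    (hpw : latN p ≤ w) :
    ∀ᵐ z ∂μ, ∀ t ∈ tube (ϱ / latN p), 𝒜 (latMove (V + z') p t) z = 𝒜 (V + z') z := by
  have hU₀ : V + z' ∈ 𝒦₁ := by
    simpa using hN2 V hV zeroDir (by simp [hw.le]) z' hz'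
  have hin : ∀ t : ℂ, ‖t‖ < 1 → latMove (V + z') p t ∈ 𝒦₁ := by
    intro t ht
    rw [latMove_add_right, ← latMove_smulDir]
    refine hN2 V hV (smulDir t p) ?_ z' hz'
    rw [latN_smulDir]
    calc ‖t‖ * latN p ≤ 1 * w := mul_le_mul ht.le hpw hp.le zero_le_one
      _ = w := one_mul w
  have h := exponent_const_on_tube_of_realBase hB hE hϱ hU₀ hp hpw one_pos hin
  simpa only [latMove_zero] using h

/-- **COROLLARY — LOCAL BACKGROUND-INDEPENDENCE.**  Same binders: at every point `V + z'` (`V ∈ 𝒦₂`, `z' ∈ D₁`) the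
exponent does not see ANY bond-field perturbation `f` of sup-norm `≤ w`: `𝒜 (V + z' + f) = 𝒜 (V + z')` a.e.  In the v1.1
lattice capstone `transportsFromVar_of_exponentSlices_lattice` these are its binders `hB k`, `hE k`, `hN2 (k+1)`, `hw`,
`hϱ` (`exponent_locallyConst_of_capstone_binders`): at every met step `k ≤ K − 2` the weights `expWeight (base k) (𝒜 k)`
are background-INDEPENDENT on the sup-ball of radius `w` about every configuration `U + z`, `U ∈ 𝒦 b k' (k+2)`,
`z ∈ D (k+1)` — the base points at which the step-`(k+1)` recursion `hFn` evaluates the step-`k` operation; an exponent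
depending non-trivially on the background near any such point cannot inhabit the binders (the last met step, and steps
whose next window is empty, escape).  §8's witness met `RealBase` only because its window `realBall` has empty interior
in `ℂ`; §K's windows are complex bond balls.  Nothing landed is false: the SEAM of §7 is mis-cut relative to p. 379,
where reality holds at the real configuration `(U,0)` UNDER the complex point `(𝐔,𝐉)`, not at `(𝐔,𝐉)` — see §10.
[folklore] -/
theorem exponent_locallyConst_lattice {𝒦₁ 𝒦₂ D₁ : Set (Fld d R)} {base : Fld d R → ℝ}
    {𝒜 : Fld d R → Fld d R → ℂ} {μ : Measure (Fld d R)} {w ϱ s : ℝ} (hw : 0 < w) (hϱ : 0 < ϱ)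
    (hB : RealBase base 𝒜 μ 𝒦₁) (hE : ExponentSlice 𝒜 μ latMove latN 𝒦₁ w ϱ s)
    (hN2 : ∀ U₀ ∈ 𝒦₂, ∀ p : NDir d R, latN p ≤ w → ∀ z' ∈ D₁, latMove U₀ p 1 + z' ∈ 𝒦₁)
    {V : Fld d R} (hV : V ∈ 𝒦₂) {z' : Fld d R} (hz' : z' ∈ D₁) (f : Fld d R) (hf : ∀ x ν, ‖f x ν‖ ≤ w) :
    ∀ᵐ z ∂μ, 𝒜 (V + z' + f) z = 𝒜 (V + z') z := by
  have h := exponent_const_on_tube_lattice (p := fldDir f w hf) hw hϱ hB hE hN2 hV hz' hw le_rfl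
  have h1 : (1 : ℂ) ∈ tube (ϱ / latN (fldDir f w hf)) := by
    rw [latN_fldDir]
    simpa using ofReal_mem_tube (div_pos hϱ hw) (right_mem_Icc.mpr (zero_le_one (α := ℝ)))
  filter_upwards [h] with z hz
  simpa only [latMove_fldDir_one] using hz 1 h1

variable {F : Type*} [NormedAddCommGroup F] [NormedSpace ℂ F]

/-- **… HENCE BACKGROUND-INDEPENDENT WEIGHTS AND OPERATION.**  Under the same binders the exponent-form weights agree a.e.
at `V + z' + f` and `V + z'`, and the normalised operation `wOp (expWeight base 𝒜) μ z₀` takes the same value there on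
EVERY integrand. [folklore] -/
theorem wOp_expWeight_locallyConst_lattice {𝒦₁ 𝒦₂ D₁ : Set (Fld d R)} {base : Fld d R → ℝ}
    {𝒜 : Fld d R → Fld d R → ℂ} {μ : Measure (Fld d R)} {w ϱ s : ℝ} (hw : 0 < w) (hϱ : 0 < ϱ)
    (hB : RealBase base 𝒜 μ 𝒦₁) (hE : ExponentSlice 𝒜 μ latMove latN 𝒦₁ w ϱ s)
    (hN2 : ∀ U₀ ∈ 𝒦₂, ∀ p : NDir d R, latN p ≤ w → ∀ z' ∈ D₁, latMove U₀ p 1 + z' ∈ 𝒦₁)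
    {V : Fld d R} (hV : V ∈ 𝒦₂) {z' : Fld d R} (hz' : z' ∈ D₁) (f : Fld d R) (hf : ∀ x ν, ‖f x ν‖ ≤ w)
    (z₀ : Fld d R) (g : Fld d R → F) :
    expWeight base 𝒜 (V + z' + f) =ᵐ[μ] expWeight base 𝒜 (V + z') ∧
      wOp (expWeight base 𝒜) μ z₀ (V + z' + f) g = wOp (expWeight base 𝒜) μ z₀ (V + z') g := by
  have hae : expWeight base 𝒜 (V + z' + f) =ᵐ[μ] expWeight base 𝒜 (V + z') := by
    filter_upwards [exponent_locallyConst_lattice hw hϱ hB hE hN2 hV hz' f hf] with z hz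
    rw [expWeight_apply, expWeight_apply, hz]
  exact ⟨hae, wOp_congr_ae z₀ hae g⟩

/-- **THE FINDING IN THE CAPSTONE'S OWN BINDERS.**  For the binder family of `transportsFromVar_of_exponentSlices_lattice`
(`hw`, `hϱ`, `hB`, `hE`, `hN2` VERBATIM) and any `b, k', k` with `k + 2 ≤ B.K` and the gate met below `k + 1`: at scale
`k + 1`, the step-`k` exponent `𝒜 k` is locally background-independent around every configuration `V + z'`,
`V ∈ 𝒦 b k' (k+2)`, `z' ∈ D (k+1)`. [folklore] -/
theorem exponent_locallyConst_of_capstone_binders {B : Booking} {Gate : ℕ → Prop}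
    {𝒦 : B.Birth → ℕ → ℕ → Set (Fld d R)} {base : ℕ → Fld d R → ℝ} {𝒜 : ℕ → Fld d R → Fld d R → ℂ}
    {μ : ℕ → Measure (Fld d R)} {D : ℕ → Set (Fld d R)} {w : ℝ} {s : ℕ → ℝ} {ϱ : B.Birth → ℕ → ℕ → ℝ}
    (hw : 0 < w) (hϱ : ∀ b k' k, 0 < ϱ b k' k)
    (hB : ∀ (b : B.Birth) (k' k : ℕ), B.birthScale b ≤ k' → k' ≤ k → k + 1 ≤ B.K → RanBelow Gate (k + 1) →
      RealBase (base k) (𝒜 k) (μ k) (𝒦 b k' (k + 1)))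
    (hE : ∀ (b : B.Birth) (k' k : ℕ), B.birthScale b ≤ k' → k' ≤ k → k + 1 ≤ B.K → RanBelow Gate (k + 1) →
      ExponentSlice (𝒜 k) (μ k) latMove latN (𝒦 b k' (k + 1)) w (ϱ b k' k) (s k))
    (hN2 : ∀ (b : B.Birth) (k' k : ℕ), B.birthScale b ≤ k' → k' ≤ k → k + 1 ≤ B.K →
      ∀ U₀ ∈ 𝒦 b k' (k + 1), ∀ p : NDir d R, latN p ≤ w → ∀ z' ∈ D k, latMove U₀ p 1 + z' ∈ 𝒦 b k' k)
    {b : B.Birth} {k' k : ℕ} (hbk' : B.birthScale b ≤ k') (hk'k : k' ≤ k) (hk : k + 2 ≤ B.K)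
    (hran : RanBelow Gate (k + 1)) {V : Fld d R} (hV : V ∈ 𝒦 b k' (k + 2)) {z' : Fld d R}
    (hz' : z' ∈ D (k + 1)) (f : Fld d R) (hf : ∀ x ν, ‖f x ν‖ ≤ w) :
    ∀ᵐ z ∂μ k, 𝒜 k (V + z' + f) z = 𝒜 k (V + z') z :=
  exponent_locallyConst_lattice hw (hϱ b k' k) (hB b k' k hbk' hk'k (by omega) hran)
    (hE b k' k hbk' hk'k (by omega) hran) (hN2 b k' (k + 1) hbk' (by omega) hk) hV hz' f hf

end LatticeDegeneracy

/-! ## §10 THE RE-CUT SEAM (v1.2): reality and oscillation at a REFERENCE configuration `ref U₀` [folklore] -/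

section ExponentAt

variable {Z : Type*} {𝒰 : Type*} [MeasurableSpace Z] {Dir : Type*}

/-- HYPOTHESIS SHAPE — **THE EXPONENT SLICE ABOUT A REFERENCE** (printed TYPE, NOT asserted): as `ExponentSlice`, but
the oscillation is measured against the exponent AT THE REFERENCE configuration `ref U₀`:
`‖𝒜_{move U₀ d t}(z) − 𝒜_{ref U₀}(z)‖ ≤ s`.  [cell reading, never asserted: `ref (𝐔,𝐉) = (U,0)` — p. 379 *"the
operation 𝐓′_k(X) can be represented as the operation for a regular G-valued configuration U, with the additional small,
and possible complex valued, term in the exponential"*; `ref = id` is v1.1's `ExponentSlice`.] [folklore] -/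
def ExponentSliceAt (ref : 𝒰 → 𝒰) (𝒜 : 𝒰 → Z → ℂ) (μ : Measure Z) (move : 𝒰 → Dir → ℂ → 𝒰) (N : Dir → ℝ)
    (𝒦 : Set 𝒰) (w ϱ s : ℝ) : Prop :=
  ∀ U₀ ∈ 𝒦, ∀ d : Dir, 0 < N d → N d ≤ w →
    ∃ Ω : Set ℂ, IsOpen Ω ∧ (∀ x ∈ Icc (0 : ℝ) 1, closedBall (x : ℂ) (ϱ / N d) ⊆ Ω) ∧
      (∀ t ∈ Ω, AEStronglyMeasurable (𝒜 (move U₀ d t)) μ) ∧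
      (∀ᵐ z ∂μ, DifferentiableOn ℂ (fun t => 𝒜 (move U₀ d t) z) Ω) ∧
      (∀ᵐ z ∂μ, ∀ t ∈ Ω, ‖𝒜 (move U₀ d t) z - 𝒜 (ref U₀) z‖ ≤ s)

/-- HYPOTHESIS SHAPE — **THE REAL REGULAR REFERENCE** (printed TYPE + the not-printed interior-point clause; NOT
asserted): `base ≥ 0` a.e. with `μ (support base) > 0`, and at the REFERENCE `ref U₀` of every window point `U₀ ∈ 𝒦`:
`𝒜_{ref U₀}` a.e.-strongly measurable and REAL a.e., `base · e^{−Re 𝒜_{ref U₀}}` integrable.  Reality is asked ONLY on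
the image of `ref` (the real regular configurations), so a complex-OPEN window is allowed (§11) — contrast §9. [folklore] -/
def RealBaseAt (ref : 𝒰 → 𝒰) (base : Z → ℝ) (𝒜 : 𝒰 → Z → ℂ) (μ : Measure Z) (𝒦 : Set 𝒰) : Prop :=
  0 ≤ᵐ[μ] base ∧ 0 < μ (Function.support base) ∧
    ∀ U₀ ∈ 𝒦, AEStronglyMeasurable (𝒜 (ref U₀)) μ ∧ (∀ᵐ z ∂μ, (𝒜 (ref U₀) z).im = 0) ∧
      Integrable (baseDensity base 𝒜 (ref U₀)) μ

/-- v1.1's `RealBase` IS the case `ref = id`. [folklore] -/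
theorem realBaseAt_id_iff (base : Z → ℝ) (𝒜 : 𝒰 → Z → ℂ) (μ : Measure Z) (𝒦 : Set 𝒰) :
    RealBaseAt id base 𝒜 μ 𝒦 ↔ RealBase base 𝒜 μ 𝒦 := Iff.rfl

/-- v1.1's `ExponentSlice` IS the case `ref = id`. [folklore] -/
theorem exponentSliceAt_id_iff (𝒜 : 𝒰 → Z → ℂ) (μ : Measure Z) (move : 𝒰 → Dir → ℂ → 𝒰) (N : Dir → ℝ)
    (𝒦 : Set 𝒰) (w ϱ s : ℝ) :
    ExponentSliceAt id 𝒜 μ move N 𝒦 w ϱ s ↔ ExponentSlice 𝒜 μ move N 𝒦 w ϱ s := Iff.rfl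

variable {ref : 𝒰 → 𝒰} {base : Z → ℝ} {𝒜 : 𝒰 → Z → ℂ} {μ : Measure Z} {move : 𝒰 → Dir → ℂ → 𝒰}
  {N : Dir → ℝ} {𝒦 : Set 𝒰} {w ϱ s : ℝ}

/-- **THE RE-CUT CONSTRUCTOR — §3's `WeightSlice` FROM EXPONENT DATA ABOUT A REFERENCE.**  `ρ₀ = base · e^{−Re 𝒜_{ref U₀}}`
(`t`-INDEPENDENT, `≥ 0` a.e., integrable, positive mass), `σ_t = 𝒜_{ref U₀} − 𝒜_{move U₀ d t}` (a.e.-measurable,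
holomorphic in `t`, `‖σ_t‖ ≤ s`), factorisation `ω_{move U₀ d t} = ρ₀ · e^{σ_t}` a.e. by `expWeight_eq_weight` AT `ref U₀`.
v1.1's `weightSlice_of_exponentSlice` is the case `ref = id`. [folklore] -/
theorem weightSlice_of_exponentSliceAt (hB : RealBaseAt ref base 𝒜 μ 𝒦)
    (hE : ExponentSliceAt ref 𝒜 μ move N 𝒦 w ϱ s) : WeightSlice (expWeight base 𝒜) μ move N 𝒦 w ϱ s := by
  intro U₀ hU₀ d hd hdw
  obtain ⟨Ω, hΩ, hballs, hAm, hAd, hAb⟩ := hE U₀ hU₀ d hd hdw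
  obtain ⟨hb, hpos, hB'⟩ := hB
  obtain ⟨hm0, hre, hint⟩ := hB' U₀ hU₀
  refine ⟨Ω, hΩ, hballs, baseDensity base 𝒜 (ref U₀), baseDensity_nonneg_ae hb 𝒜 (ref U₀), hint,
    integral_baseDensity_pos hb hint hpos, fun t z => 𝒜 (ref U₀) z - 𝒜 (move U₀ d t) z,
    fun t ht => hm0.sub (hAm t ht), ?_, ?_, ?_⟩
  · filter_upwards [hAd] with z hz
    exact (differentiableOn_const _).sub hz
  · filter_upwards [hAb] with z hz t ht
    rw [norm_sub_rev]
    exact hz t ht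
  · intro t _
    filter_upwards [hre] with z hz
    exact expWeight_eq_weight hz

variable {F : Type*} [NormedAddCommGroup F] [NormedSpace ℂ F]

/-- **THE SUPPLIER IN THE RE-CUT CURRENCY**: real regular reference + exponent slice about it with `s ≤ 1` + a window
`D` of full measure ⇒ §L's `OpSliceOn (BddClass F μ) (wOp (expWeight base 𝒜) μ z₀) D move N 𝒦 w ϱ (e^{3s})`. [folklore] -/
theorem opSliceOn_wOp_expAt {D : Set Z} (z₀ : Z) (hB : RealBaseAt ref base 𝒜 μ 𝒦)
    (hE : ExponentSliceAt ref 𝒜 μ move N 𝒦 w ϱ s) (hs : s ≤ 1) (hD : ∀ᵐ z ∂μ, z ∈ D) :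
    OpSliceOn (BddClass F μ) (wOp (expWeight base 𝒜) μ z₀) D move N 𝒦 w ϱ (Real.exp (3 * s)) :=
  opSliceOn_wOp z₀ (weightSlice_of_exponentSliceAt hB hE) hs hD

end ExponentAt

section ConsumptionLatticeExpAt

open T4BirthChartTransport (GaugeInvariant BirthSlice RelGauge)
open T4BlockTransport (Fld NDir latMove latN)

variable {B : Booking} {T : Trajectory B}
variable {R : Type*} [NormedRing R] [NormedAlgebra ℂ R] [MeasurableSpace R] {d : ℕ}
  {F : Type*} [NormedAddCommGroup F] [NormedSpace ℂ F] [CompleteSpace F]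

/-- **THE DRESSED PIPELINE ON `ℤ^d` FED BY EXPONENT DATA ABOUT REFERENCES (v1.2)** — `transportsFromVar_of_exponentSlices_lattice`
VERBATIM except that, per met step `k`, the real regular base `hB` and the exponent slice `hE` are stated ABOUT A
REFERENCE MAP `ref k : Fld d R → Fld d R` (`RealBaseAt` / `ExponentSliceAt`); `ref k = id` is v1.1.  SAME conclusion
`T.TransportsFromVar (4c_δ/r) (fun i => ψ·α i) Gate`; unlike v1.1 the binders admit genuine background dependence at
every met step on complex-open windows (§9 vs §11). [folklore] -/
theorem transportsFromVar_of_exponentSlicesAt_lattice {Gate : ℕ → Prop} {Fn : B.Birth → ℕ → ℕ → Fld d R → F}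
    {rel : B.Birth → ℕ → ℕ → Fld d R → Fld d R → Prop} {𝒦 : B.Birth → ℕ → ℕ → Set (Fld d R)}
    {ref : ℕ → Fld d R → Fld d R} {base : ℕ → Fld d R → ℝ} {𝒜 : ℕ → Fld d R → Fld d R → ℂ}
    {μ : ℕ → Measure (Fld d R)} {z₀ : ℕ → Fld d R} {D : ℕ → Set (Fld d R)}
    {defect : B.Birth → ℕ → ℕ → ℝ} {cδ ψ w r : ℝ} {s α θ : ℕ → ℝ} {ϱ : B.Birth → ℕ → ℕ → ℝ}
    (hα : ∀ i, 0 ≤ α i) (hr : 0 < r) (hw : 0 < w)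
    (hsl : ∀ (b : B.Birth) (k' : ℕ), B.birthScale b ≤ k' → k' ≤ B.K → RanBelow Gate k' →
      BirthSlice (Fn b k' k') latMove latN (𝒦 b k' k') w r (T.gen b k'))
    (hFn : ∀ (b : B.Birth) (k' k : ℕ), B.birthScale b ≤ k' → k' ≤ k → k + 1 ≤ B.K → RanBelow Gate (k + 1) →
      ∀ U, Fn b k' (k + 1) U = wOp (expWeight (base k) (𝒜 k)) (μ k) (z₀ k) U (fun z => Fn b k' k (U + z)))
    (h𝒢 : ∀ (b : B.Birth) (k' k : ℕ), B.birthScale b ≤ k' → k' ≤ k → k + 1 ≤ B.K → RanBelow Gate (k + 1) →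
      ∀ U, (fun z => Fn b k' k (U + z)) ∈ BddClass F (μ k))
    (hD : ∀ k, (D k).Nonempty) (hϱ : ∀ b k' k, 0 < ϱ b k' k)
    (hB : ∀ (b : B.Birth) (k' k : ℕ), B.birthScale b ≤ k' → k' ≤ k → k + 1 ≤ B.K → RanBelow Gate (k + 1) →
      RealBaseAt (ref k) (base k) (𝒜 k) (μ k) (𝒦 b k' (k + 1)))
    (hE : ∀ (b : B.Birth) (k' k : ℕ), B.birthScale b ≤ k' → k' ≤ k → k + 1 ≤ B.K → RanBelow Gate (k + 1) →
      ExponentSliceAt (ref k) (𝒜 k) (μ k) latMove latN (𝒦 b k' (k + 1)) w (ϱ b k' k) (s k))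
    (hs : ∀ k, s k ≤ 1) (hDμ : ∀ k, ∀ᵐ z ∂μ k, z ∈ D k)
    (hN1 : ∀ (b : B.Birth) (k' k : ℕ), B.birthScale b ≤ k' → k' ≤ k → k + 1 ≤ B.K →
      ∀ z ∈ D k, ∀ U ∈ 𝒦 b k' (k + 1), U + z ∈ 𝒦 b k' k)
    (hN2 : ∀ (b : B.Birth) (k' k : ℕ), B.birthScale b ≤ k' → k' ≤ k → k + 1 ≤ B.K →
      ∀ U₀ ∈ 𝒦 b k' (k + 1), ∀ p : NDir d R, latN p ≤ w → ∀ z' ∈ D k, latMove U₀ p 1 + z' ∈ 𝒦 b k' k)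
    (hdiam : ∀ k, ∀ z ∈ D k, ∀ z' ∈ D k, ∀ x ν, ‖z x ν - z' x ν‖ ≤ θ k)
    (hθ : ∀ k, 0 < θ k ∧ θ k ≤ w)
    (hdom : ∀ (b : B.Birth) (k' k : ℕ), B.birthScale b ≤ k' → k' ≤ k → k + 1 ≤ B.K →
      Real.exp (3 * s k) * (1 + 4 * θ k / ϱ b k' k) ≤ α k)
    (hinv : ∀ b k' k, GaugeInvariant (rel b k' k) (Fn b k' k))
    (hdefw : ∀ b k' k, defect b k' k ≤ w)
    (hrate : ∀ (b : B.Birth) (k' k : ℕ), B.birthScale b ≤ k' → k' ≤ k → k ≤ B.K →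
      defect b k' k ≤ cδ * ψ ^ (k - k'))
    (hlin : ∀ (b : B.Birth) (k' k : ℕ), B.birthScale b ≤ k' → k' ≤ k → k ≤ B.K → RanBelow Gate k → ∀ ε > 0,
      ∃ U₀ ∈ 𝒦 b k' k, ∃ U₁ : Fld d R, RelGauge (rel b k' k) latMove latN U₀ U₁ (defect b k' k) ∧
        T.lin b k' k ≤ ‖Fn b k' k U₁ - Fn b k' k U₀‖ + ε) :
    T.TransportsFromVar (4 * cδ / r) (fun i => ψ * α i) Gate :=
  transportsFromVar_of_weightSlices_lattice (ω := fun k => expWeight (base k) (𝒜 k)) hα hr hw hsl hFn h𝒢 hD hϱ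
    (fun b k' k hbk' hk'k hk hran =>
      weightSlice_of_exponentSliceAt (hB b k' k hbk' hk'k hk hran) (hE b k' k hbk' hk'k hk hran))
    hs hDμ hN1 hN2 hdiam hθ hdom hinv hdefw hrate hlin

end ConsumptionLatticeExpAt

/-! ## §11 Non-vacuity of the re-cut currency ON A COMPLEX-OPEN WINDOW, where the v1.1 currency is refuted (toy) -/

section WitnessExpAt

/-- The reference map of the toy: the real point under a complex one, `ref U = Re U`. [folklore] -/
def reRef (U : ℂ) : ℂ := ((U.re : ℝ) : ℂ)

/-- **v1.1's `RealBase` FAILS on the complex window**: at `U₀ = i ∈ closedBall 0 1` the toy exponent `−c·i·z` has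
imaginary part `−c·z ≠ 0` for `z ∈ (0,1]`, a set of positive Lebesgue measure — reality at EVERY window point is
unavailable as soon as the window has complex interior and the exponent depends on the background (`c ≠ 0`). [folklore] -/
theorem not_realBase_linExp_closedBall {c : ℝ} (hc : c ≠ 0) :
    ¬ RealBase (fun _ : ℝ => (1 : ℝ)) (linExp c) (volume.restrict (Icc (0 : ℝ) 1)) (closedBall (0 : ℂ) 1) := by
  intro h
  have hI : Complex.I ∈ closedBall (0 : ℂ) 1 := by simp [Complex.norm_I]
  have hre := (h.2.2 Complex.I hI).2.1
  have him : ∀ z : ℝ, (linExp c Complex.I z).im = -(c * z) := fun z => by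
    simp [linExp, Complex.mul_im, Complex.mul_re]
  simp only [him, neg_eq_zero, mul_eq_zero, hc, false_or] at hre
  rw [ae_iff, Measure.restrict_apply' measurableSet_Icc] at hre
  have hle : volume (Ioc (0 : ℝ) 1) ≤ volume ({z : ℝ | ¬ z = 0} ∩ Icc (0 : ℝ) 1) :=
    measure_mono fun z hz => ⟨ne_of_gt hz.1, Ioc_subset_Icc_self hz⟩
  rw [hre, Real.volume_Ioc] at hle
  norm_num at hle

/-- **`RealBaseAt reRef` IS MET on the complex window**: at the real reference `Re U₀` the toy exponent `−c·Re U₀·z` is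
continuous and REAL, and `e^{−Re 𝒜}` is integrable on `[0,1]`. [folklore] -/
theorem realBaseAt_linExp_closedBall (c : ℝ) :
    RealBaseAt reRef (fun _ : ℝ => (1 : ℝ)) (linExp c) (volume.restrict (Icc (0 : ℝ) 1)) (closedBall (0 : ℂ) 1) := by
  refine ⟨Eventually.of_forall fun _ => zero_le_one, ?_, fun U₀ _ => ⟨?_, ?_, ?_⟩⟩
  · rw [Function.support_const one_ne_zero, Measure.restrict_apply_univ, Real.volume_Icc]
    norm_num
  · exact Continuous.aestronglyMeasurable (by unfold linExp reRef; fun_prop)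
  · exact Eventually.of_forall fun z => by
      simp [linExp, reRef, Complex.mul_im, Complex.mul_re]
  · show IntegrableOn _ _ _
    exact Continuous.integrableOn_Icc (by unfold baseDensity linExp reRef; fun_prop)

/-- **`ExponentSliceAt reRef` IS MET on the complex window** with `move U _ t = U + t`, unit window norm, `w = ϱ = 1`,
oscillation `s` for `c = s/5`, every `s ≥ 0`: `Ω = ball 0 3`, holomorphy of `t ↦ −c·(U₀ + t)·z`, and
`‖𝒜_{U₀+t}(z) − 𝒜_{Re U₀}(z)‖ = c·‖U₀ + t − Re U₀‖·|z| ≤ (s/5)·(1 + 3 + 1)·1` on `Ω × [0,1]`. [folklore] -/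
theorem exponentSliceAt_linExp_closedBall {s : ℝ} (hs : 0 ≤ s) :
    ExponentSliceAt (Dir := Unit) reRef (linExp (s / 5)) (volume.restrict (Icc (0 : ℝ) 1)) (fun U _ t => U + t)
      (fun _ => 1) (closedBall (0 : ℂ) 1) 1 1 s := by
  intro U₀ hU₀ d _ _
  have hU : ‖U₀‖ ≤ 1 := by simpa using hU₀
  refine ⟨ball 0 3, isOpen_ball, ?_, ?_, ?_, ?_⟩
  · intro x hx t ht
    rw [mem_closedBall, dist_eq_norm] at ht
    rw [mem_ball, dist_zero_right]
    have hx' : ‖(x : ℂ)‖ ≤ 1 := by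
      rw [Complex.norm_real, Real.norm_eq_abs, abs_le]; constructor <;> linarith [hx.1, hx.2]
    calc ‖t‖ = ‖(t - x) + x‖ := by rw [sub_add_cancel]
      _ ≤ ‖t - (x : ℂ)‖ + ‖(x : ℂ)‖ := norm_add_le _ _
      _ ≤ 1 / 1 + 1 := add_le_add ht hx'
      _ < 3 := by norm_num
  · intro t _
    exact Continuous.aestronglyMeasurable (by unfold linExp; fun_prop)
  · exact Eventually.of_forall fun z => by
      show DifferentiableOn ℂ (fun t : ℂ => linExp (s / 5) (U₀ + t) z) (ball 0 3)
      unfold linExp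
      fun_prop
  · filter_upwards [ae_restrict_mem measurableSet_Icc] with z hz t ht
    rw [mem_ball, dist_zero_right] at ht
    have hz' : ‖(z : ℂ)‖ ≤ 1 := by
      rw [Complex.norm_real, Real.norm_eq_abs, abs_le]; constructor <;> linarith [hz.1, hz.2]
    have hre' : ‖((U₀.re : ℝ) : ℂ)‖ ≤ 1 := by
      rw [Complex.norm_real, Real.norm_eq_abs]
      exact (Complex.abs_re_le_norm U₀).trans hU
    have hdiff : linExp (s / 5) (U₀ + t) z - linExp (s / 5) (reRef U₀) z =
        -((((s / 5 : ℝ)) : ℂ) * (U₀ + t - ((U₀.re : ℝ) : ℂ)) * (z : ℂ)) := by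
      unfold linExp reRef; ring
    have hn : ‖U₀ + t - ((U₀.re : ℝ) : ℂ)‖ ≤ 5 :=
      calc ‖U₀ + t - ((U₀.re : ℝ) : ℂ)‖ ≤ ‖U₀ + t‖ + ‖((U₀.re : ℝ) : ℂ)‖ := norm_sub_le _ _
        _ ≤ (‖U₀‖ + ‖t‖) + ‖((U₀.re : ℝ) : ℂ)‖ := by gcongr; exact norm_add_le _ _
        _ ≤ (1 + 3) + 1 := by gcongr
        _ = 5 := by norm_num
    rw [hdiff, norm_neg, norm_mul, norm_mul, Complex.norm_real, Real.norm_eq_abs,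
      abs_of_nonneg (by positivity)]
    calc s / 5 * ‖U₀ + t - ((U₀.re : ℝ) : ℂ)‖ * ‖(z : ℂ)‖ ≤ s / 5 * 5 * 1 := by gcongr
      _ = s := by ring

/-- **NON-VACUITY OF THE RE-CUT CONSTRUCTOR ON A COMPLEX-OPEN WINDOW**: the toy's exponent data about the real
references give §3's weight slice for the weights `expLin (s/5)` over the CLOSED UNIT DISC of `ℂ`, every `s ≥ 0` — with
GENUINE background dependence (`ω_U(z) = e^{(s/5)·U·z}`), where v1.1's `RealBase` is refuted
(`not_realBase_linExp_closedBall`). [folklore] -/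
theorem weightSlice_linExp_closedBall {s : ℝ} (hs : 0 ≤ s) :
    WeightSlice (Dir := Unit) (expWeight (fun _ : ℝ => (1 : ℝ)) (linExp (s / 5)))
      (volume.restrict (Icc (0 : ℝ) 1)) (fun U _ t => U + t) (fun _ => 1) (closedBall (0 : ℂ) 1) 1 1 s :=
  weightSlice_of_exponentSliceAt (realBaseAt_linExp_closedBall (s / 5)) (exponentSliceAt_linExp_closedBall hs)

/-- … hence, at `s = 1`, §L's guarded operator slice for the honest normalised operation with the printed-shape constant
`a = e³` over the complex window, fed by exponent data about references. [folklore] -/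
example : OpSliceOn (𝒰 := ℂ) (Dir := Unit) (BddClass ℂ (volume.restrict (Icc (0 : ℝ) 1)))
    (wOp (expWeight (fun _ : ℝ => (1 : ℝ)) (linExp (1 / 5))) (volume.restrict (Icc (0 : ℝ) 1)) 0) (Icc (0 : ℝ) 1)
    (fun U _ t => U + t) (fun _ => 1) (closedBall (0 : ℂ) 1) 1 1 (Real.exp (3 * 1)) :=
  opSliceOn_wOp_expAt (F := ℂ) 0 (realBaseAt_linExp_closedBall (1 / 5)) (exponentSliceAt_linExp_closedBall zero_le_one)
    le_rfl (ae_restrict_mem measurableSet_Icc)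

/-- **THE WITNESS IS NOT DEGENERATE**: along the slice from `U₀ = 0` the toy exponent MOVES — `𝒜_{0+t}(z) ≠ 𝒜_0(z)` at
`t = 1`, `z = 1` — which §9 forbids for any inhabitant of the v1.1 shapes at an interior point. [folklore] -/
theorem linExp_slice_not_const {c : ℝ} (hc : c ≠ 0) : linExp c ((0 : ℂ) + 1) 1 ≠ linExp c 0 1 := by
  simp [linExp, hc]

end WitnessExpAt

end

end Literature.MathematicalPhysics.QuantumFieldTheory.Balaban1983to89.T4TrajectoryDensity
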